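import Summits.HodgeConjecture.HodgeConjecture.Theses.PadicSemiregularLift
import Literature.AlgebraicGeometry.Motives.AbelianVarietyProjectiveChart
import Literature.AlgebraicGeometry.Motives.AbelianVarietyDimZeroProofs
import Literature.AlgebraicGeometry.Motives.VarietiesUnitProofs
import Literature.AlgebraicGeometry.Motives.VarietiesGeometricallyIntegralProofs
import Literature.AlgebraicGeometry.Motives.VarietiesDimensionProofs
import Literature.AlgebraicGeometry.Motives.ComplexPointsManifold
import Literature.AlgebraicTopology.SingularHomology.CohomologyOfPoint
import Literature.AlgebraicGeometry.HodgeTheory.HodgeModelExistence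
import Literature.AlgebraicGeometry.HodgeTheory.LefschetzOneOne
import Literature.AlgebraicGeometry.HodgeTheory.HardLefschetzNFold
import Literature.AlgebraicGeometry.HodgeTheory.TopDegreeClasses
import Literature.AlgebraicGeometry.HodgeTheory.WeilClassesFourfolds
import Literature.AlgebraicGeometry.HodgeTheory.HodgeFiltrationModels
import Literature.Barriers.HodgeConjecture.KaehlerCoherentSheaves
import Literature.Barriers.HodgeConjecture.IntegralCoefficients
import Summits.HodgeConjecture.HodgeConjecture.Theses.TropicalCuspLift
-- import Summits.HodgeConjecture.HodgeConjecture.Theses.HeckeOrbitCompactness  -- dropped in v4 (cycle 4): the farm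
-- served this route module incoherently during the crux-write verification; the two §7 theorems that need it are
-- LANDED in `Theorems/HodgeAbelianVarieties/Negative/KillTransfer.lean` (p73980) and kept below as comments.
import Summits.HodgeConjecture.HodgeConjecture.Theses.DegreeSpectroscopy
import Summits.HodgeConjecture.HodgeConjecture.Theses.HeckePrymWeil
import Summits.HodgeConjecture.HodgeConjecture.Theses.NodalThetaWeil
import Summits.HodgeConjecture.HodgeConjecture.Theses.SupersingularIsotypicLift
import Summits.HodgeConjecture.HodgeConjecture.Theses.ConservativityLefschetz
import Literature.Barriers.HodgeConjecture.ExceptionalHodgeClasses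
import Literature.AlgebraicGeometry.HodgeTheory.WeilClasses
import Literature.AlgebraicGeometry.HodgeTheory.MotivatedClasses
import Literature.AlgebraicGeometry.Motives.HyperbolicWeilType
import Literature.AlgebraicGeometry.HodgeTheory.AtiyahClassTraceReal
import Literature.AlgebraicGeometry.HodgeTheory.ChernCharacterBetti
import Literature.AlgebraicGeometry.HodgeTheory.GlobalInvariantCycles
import Literature.AlgebraicGeometry.Motives.FamiliesVHS
import Mathlib.AlgebraicGeometry.Morphisms.Smooth
import Literature.AlgebraicGeometry.Motives.ChernClassesProofs
import Literature.AlgebraicGeometry.HodgeTheory.HodgeConjectureQbarVoisinProofs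
import Literature.AlgebraicGeometry.Motives.CrystallineRealization
import Literature.AlgebraicGeometry.Motives.SupersingularAbelianVariety

/-!
# Disproof work file for the crux `HodgeAbelianVarieties` (stmt-HodgeConjecture-1333)

Crux (route `PadicSemiregularLift`, rank 4, typed OUTPUT item):

  `HodgeAbelianVarieties := ∀ A : AbelianVariety ℂ, HodgeConjectureFor A.dim A.X`

— the Hodge conjecture for every complex abelian variety, over the REAL carriers of the tree
(`AbelianVariety` = proper geometrically integral group scheme over `ℂ`; `A.dim` = topological Krull
dimension; `HodgeConjectureFor n X := Nonempty (HodgeModel n X) ∧ ∀ p c, IsRationalClass c →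
IsOfHodgeType n X (2p) p p c → c ∈ algebraicClasses X p`).

## Findings (cycle 1, refuter-cdisprove-stmt-HodgeConjecture-1333-0, 2026-08-15) — NO KILL

1. READ-BACK / JUNK ANALYSIS (§1). The binder ranges over genuine abelian varieties only (no junk
   inhabitant: the fields are Mathlib's `GrpObj`, `IsProper`, `GeometricallyIntegral`); `A.dim` is the
   true dimension (`AbelianVariety.topologicalKrullDim_left`); smooth-projectivity of `A.X` is PROVED in
   the tree (`AbelianVariety.isSmoothProjective_holds`), so the crux is literally the summit restricted
   to abelian varieties (`iff_hodgeConjecture_restricted`, sorry-free).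
   Hence ANY kill of this crux is a disproof of the Hodge conjecture itself (kill criterion (c) of the
   route, now formal: `not_hodgeConjecture_of_not`). The `∃`-over-Hodge-models convention of
   `IsOfHodgeType` and the anti-vacuity conjunct `Nonempty (HodgeModel …)` are the audited summit
   conventions; their rigidity is the tree's named fact `hodgePQ_independent_of_hodgeModel` (carrier
   part PROVED: `HodgeModel.exists_biholomorph`); no re-decoration attack applies (checked: naturality
   of `ComplexDeRhamIsoFamily` is over ALL real-smooth maps of manifolds charted on the model, enough
   for the Thom/pinch scalar argument; `Order.coheight` in `supportedClasses` IS codimension since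
   Mathlib's order on a scheme is `a ≤ b ↔ b ⤳ a`).
2. DEGENERATE INSTANCE (§2). `AbelianVariety ℂ` is inhabited by the zero abelian variety
   (`zeroAbelianVariety`, `dim = 0`, sorry-free); there the crux is EXACTLY the anti-vacuity conjunct
   `Nonempty (HodgeModel 0 (Spec ℂ))` (`hodgeConjectureFor_iff_nonempty_hodgeModel_of_dim_eq_zero`,
   sorry-free: `H^{2p}(pt) = 0` for `p ≥ 1`), which holds in print and follows from the named fact
   `nonempty_hodgeModel` (`hodgeConjectureFor_zeroAbelianVariety`). Not false at the junk end.
3. WHERE A COUNTEREXAMPLE MUST LIVE (§3, sorry-free + fact-conditional). Unconditionally the extreme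
   codimensions are harmless (`p = 0`: everything algebraic; `p ≥ dim A ≥ 1`: top degree / zero group —
   `mem_algebraicClasses_of_dim_le`), so `HodgeAbelianVarieties ↔ (models) ∧ (1 ≤ p < dim A)`
   (`hodgeAbelianVarieties_iff_middle`). Granting the tree's named facts Lefschetz `(1,1)`
   (`lefschetzOneOne_rational`) and hard Lefschetz (`nonempty_hardLefschetzNFold`), a minimal
   counterexample has `2 ≤ p`, `2p ≤ dim A`, so `dim A ≥ 4` (`hodgeAbelianVarieties_iff_deepMiddle`);
   `dim A ≤ 3` is settled outright from facts (`of_dim_le_three`). In PRINT the frontier is further out: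
   HC holds for abelian varieties of dimension `≤ 5` (Markman, arXiv:2509.23403 Cor. 1.3, from Thm. 1.2
   = Weil classes on ALL abelian fourfolds of Weil type + Moonen–Zarhin + Ramón Marí; the fourfold
   Weil-plane half is the tree fact `Markman2025_weilClasses_algebraic_abelianFourfold`), for simple
   abelian varieties of prime dimension (Tankeev) and wherever the Hodge ring is divisor-generated
   (Mattuck general AV, Tate/Imai products of elliptic curves). FIRST OPEN CASES (arXiv:2603.20268 p. 3,
   read): Weil classes on abelian SIXFOLDS of Weil type with discriminant ≠ −1 (Markman covers disc −1,
   all `K`), and general Weil type in dimension `2n ≥ 8` (van Geemen LNM 1594 Thm. 4.11); CM abelian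
   varieties reduce to split Weil classes (André 1992 = Markman survey Thm. 1.4).
4. LOAD-BEARING HYPOTHESES (§4, `def …Without…` + near-miss theorems, paper proofs in docstrings).
   `isProper` dropped ⇒ FALSE (`𝔾_m`: `H¹(ℂˣ)` is spanned by `[dz/z] = -[dz̄/z̄]`, so no Hodge
   decomposition, no Hodge model). Group law dropped ⇒ FALSE for the wrong reason (singular proper
   varieties have no Hodge model: nodal cubic; and HC genuinely fails for singular varieties, barrier
   `SingularVarieties`). `geometricallyIntegral` dropped ⇒ NOT load-bearing (proper group schemes over
   `ℂ` are smooth (Cartier) with abelian identity component; HC is additive over the finitely many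
   components) — information for provers: nothing to exploit in connectedness. Coefficients: `ℚ` is
   load-bearing EVEN ON ABELIAN VARIETIES — the INTEGRAL Hodge conjecture fails on the very general
   principally polarised abelian variety of dimension `g ≥ 4` in every codimension `2 ≤ c ≤ g-1`
   (Engel–de Gaay Fortman–Schreieder 2025, arXiv:2507.15704 Thm. 1.1: every algebraic class is an EVEN
   multiple of the minimal class `[Θ]^c/c!`), so any lifting mechanism must produce the denominator `2`
   there. Rationality of the class dropped ⇒ FALSE (`H^{1,1}` of a general abelian surface has dimension
   `4 > ρ = 1`). Projectivity ⇒ Kähler tori: FALSE (Zucker 1977; Voisin 2002 Weil tori, the tree's barrier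
   `Voisin2002_weilTorus_hodgeClassWithoutSubvarieties`, re-exported in §5).
5. WHY IT RESISTS (§6). (i) Every arithmetic/Hodge-theoretic invariant that could CERTIFY
   non-algebraicity coincides for Hodge and algebraic classes on abelian varieties: Hodge classes on AVs
   are absolute Hodge (Deligne 1982; barrier `hodgeClassesAreAbsoluteFor_abelianVariety`), even MOTIVATED
   (André 1996 Thm. 0.6.2; barrier `Andre1996_hodgeClassesOnAbelianVarieties_motivated`): a counterexample
   on an abelian variety refutes Grothendieck's standard conjecture `B` for total spaces of compact
   pencils of abelian varieties. (ii) No finite or decidable model: algebraicity of a given class is a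
   Σ₁ search, NON-algebraicity has no known certificate on AVs; `kit compute` has nothing to bite on.
   (iii) The one computational programme in print — Kontsevich–Zharkov tropical degeneration
   (arXiv:2002.02347: disprove the TROPICAL Hodge conjecture for tropical Weil fourfolds; a generic member
   of the degenerating family would then be a classical counterexample) — targeted dimension 4, found no
   solution ("the solution does not hold modulo any proper sublattice of ℤ⟨θ, w₁, w₂⟩"), and is now
   PROVABLY barren in dimension 4 (Markman: Weil classes on all abelian fourfolds are algebraic, so the
   tropical Hodge conjecture holds for every tropical limit of Weil fourfolds); it would have to be re-set-up
   for non-split Weil sixfolds (12-dimensional period domain data, `Sym²Γ_p ⊗ Sym²(∧³Γ₂)` bookkeeping) —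
   not a session-sized computation and with no completeness guarantee ("the converse implication may be
   false"). (iv) All evidence since 1977 is positive and accelerating (Schoen 1988/1998, van Geemen 1994,
   Koike, Markman 2023/2025, Floccari–Fu 2025).
6. TARGETS: none (payload `targets = []`, `stuck_stubs = []`: triage panel r1 done, no line picked,
   no lead skeleton yet — cycle 2 unchanged).

## Findings (cycle 2, refuter-cdisprove-stmt-HodgeConjecture-1333-g2-0, 2026-08-16) — NO KILL

7. SECOND READ-BACK OF THE DEFINITIONS (independent of cycle 1; nothing to exploit). (i) In
   `supportedClasses X i r = ⨆ Z closed, (∀ z ∈ Z, r ≤ Order.coheight z), ker(restrict to (X∖Z)(ℂ))`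
   the preorder on scheme points is Mathlib's global one with `coheight z = dim 𝒪_{X,z}`
   (`AlgebraicGeometry.ringKrullDim_stalk_eq_coheight`, used unqualified in the tree's
   `Dimension/FibreLocalRingDimension`), so "codimension `≥ r`" is the codimension of EVERY component
   — not the dual order (which would make `algebraicClasses X p = 0` for `p ≥ 1` and the crux false for
   the wrong reason: checked, it is not). (ii) `ComplexDeRhamIsoFamily.IsNatural` quantifies over ALL
   real-`C^∞` maps between ALL real-smooth Hausdorff σ-compact manifolds charted on the model space
   (not only holomorphic maps of complex manifolds), which is exactly what the Thom/pinch argument of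
   `RationalHodgeClasses` needs (test objects `N × ℝ^{2n-k}`, degree-one pinches `N → Sᵏ`): two Hodge
   models move `H^{p,p}` by a scalar only, so the `∃`-over-models `IsOfHodgeType` cannot be inflated by
   an exotic comparison. (iii) `IsRationalClass` = represented by a `ℚ`-valued cocycle (rigid);
   `complexPointsCompl X Z = {P // P.pt ∉ Z}` (rigid). No misstatement kill exists in the typing.
8. KILL-TRANSFER HUB (§7, sorry-free). Every typed abelian-variety instance of HC elsewhere in the tree
   is BELOW the crux: `HeckeOrbitCompactness.WeilClassesAlgebraic`, `DegreeSpectroscopy.WeilClassesAlgebraic`,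
   `HeckePrymWeil.{HodgeWeilLadder, WeilSixfoldsSqrtMinus7, WeilTwelvefoldsSqrtMinus7,
   WeilTenfoldsSqrtMinus11, WeilDescending}`, `NodalThetaWeil.{WeilSixfolds, NodeDualClassesAlgebraic}`,
   `SupersingularIsotypicLift.CMAbelianHodge`, `TropicalCuspLift.{WeilClassesAlgebraic, WeilSixfolds}` (§3):
   a refutation of ANY of these thirteen items is a two-line kill of this crux (contrapositives
   `not_of_not_…`), and conversely nothing typed in the tree about abelian varieties is stronger than
   the crux except the summit itself. The crux is summit-EQUIVALENT modulo each of the complement items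
   `ConservativityLefschetz.AbelianComplement`, `HeckeOrbitCompactness.SummitOffWeilSector`,
   `HeckePrymWeil.SummitOffWeilSector` (`hodgeConjecture_iff_and_abelianComplement`). LANDED: the
   contrapositive forms, `Theorems/HodgeAbelianVarieties/Negative/KillTransfer.lean` (p73980, d64d2e5210bf).
9. NATURAL STRENGTHENING REFUTED OVER TREE VOCABULARY (§8, sorry-free from the barrier facts): the
   divisor-generated form `Bᵖ = Dᵖ` of the crux (`HodgeRingDivisorGeneratedOnAbelianVarieties`: every
   rational `(p,p)`-class is in `divisorClassesSpan A.X A.dim p`) is FALSE — Weil 1977 / van Geemen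
   Thm. 4.11 (`Weil1977_exceptionalHodgeClasses`, general Weil-type fourfold, `p = 2`) and already on a
   SIMPLE fourfold (Mumford–Pohlmann, `Mumford1968_simpleFourfold_exceptionalHodgeClasses`). For THIS
   route: at a supersingular anchor every class is a polynomial in divisors, but those divisors do not
   lift to the Weil-type generic fibre (`B¹ = ℚ` there), so the seeds must be genuinely non-divisorial
   objects; "specialise, write in divisors, lift" is not a mechanism. Also recorded (prose, §6): Hodge's
   ORIGINAL general conjecture fails on the abelian threefold `E³` (Grothendieck 1969; tree barrier
   `Grothendieck1969_generalHodgeConjecture_false`, typed over a scheme, not over `AbelianVariety`, hence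
   not restated here) — coniveau-level classwise criteria are dead on abelian varieties too, off CM.
10. COMPUTATION (§6, updated after READING arXiv:2002.02347 in full, 4 pp.): the Kontsevich–Zharkov
   scheme is NOT a finite problem — the unknown is an infinite family of linear maps
   `Φ_{x,u} : ∧²Γ₂ → Sym²Γ_p ⊗ Sym²(∧²Γ₂)` indexed by `x ∈ (Γ₂ ⊗ Γ_p)/Γ₁ ≅ ℤ¹²` and `u ∈ ℚℙ³`, subject to
   the triangle/parallelogram cocycle equations; only the authors' linearity ANSATZ makes it finite, and
   that ansatz provably cannot work ("the solution does not hold modulo any proper sublattice of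
   ℤ⟨θ, w₁, w₂⟩"); the implication "tropical HC fails for `X = V/Γ₁` ⇒ a generic `X_ε` is a classical
   counterexample" is ASSERTED in the note, not proved there; and in dimension `4` the target is now a
   theorem (Markman). A sixfold re-run needs `p = 3` cells (tetrahedra/prisms), flags of length 3,
   `Γ_p` of rank 9, with the same non-finiteness — no certificate-producing `kit` job exists; none
   submitted (numbers: 0 jobs). The only "finite computation" in the 2026 literature (arXiv:2603.20268,
   McMullen's curve `V ⊂ X_L` meeting the Weil locus: open problems O1–O3) decides EXISTENCE of rigid
   Weil-type sixfolds with uncontrolled discriminant — candidate hard cases — not non-algebraicity.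
12. POSITIVE BY-PRODUCT (§9, sorry-free): the e-step card's typed first lemma `ker_map_eq_of_ker_eq`
   (Künneth stability of Markman's Hochschild criterion, linear-algebra core) is PROVED here in full
   generality — information for the lead, not a refutation.
13. PRE-PICK LINE NOTE (§10, sorry-free): the e-step skeleton's four stubs are consequences of the
   crux (`EStepLine.all_stubs_of_crux`) — that line cannot be killed stub-wise, only found unprovable;
   the gallery / symmetry-ladder skeletons carry data interfaces (`ChernCharacterBetti`, seed packages)
   whose junk-(un)satisfiability is the first test at the next arm.
11. LITERATURE REFRESH (2026-08-16; searchd/OpenAlex/S2/arXiv degraded this session — crossref only,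
   plus the two held texts re-read): frontier unchanged since cycle 1 — fourfolds of Weil type done for
   all `(K, disc)` (Markman 2025; Floccari–Fu, JMPA 2026, doi:10.1016/j.matpur.2026.103876, disc 1 via
   singular OG6), sixfolds done for disc `-1` only (Markman), "outside this locus … completely open"
   (arXiv:2603.20268 p. 3, read); Markman's ICM 2026 report doi:10.1137/25m1803796. No counterexample
   claim in the refereed literature; SSRN items titled "counterexample … Fermat quintic" contradict
   Shioda/Lefschetz and are not about abelian varieties.

## Findings (cycle 3, refuter-cdisprove-stmt-HodgeConjecture-1333-g3-0, 2026-08-16) — NO KILL OF THE CRUX; ONE LINE STUB KILLED (paper level)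

14. NO-GO THEOREM FOR `{0,1}`-SEMIREGULAR SEEDS (§11, this cycle's main finding; paper proof complete,
   linear-algebra heart certified by `kit` job j010030). Let `(A, θ)` be ANY complex abelian variety
   with a polarisation class and `E` a finite locally free sheaf (indeed any perfect complex) with
   `(σ₀, σ₁) : Ext²(E,E) → H²(𝒪) ⊕ H³(Ω¹)` injective (`IsZeroOneSemiregular`) and `ch₁(E) ∈ ℂθ`,
   `ch₂(E) ∈ ℂθ²`. THEN `ch_q(E) ∈ ℂθ^q` FOR EVERY `q`. Proof: for a first-order deformation
   `ξ ∈ H¹(A, Θ_A)` the obstruction to extend `E` is `ob_ξ = ⟨ξ, -At(E)⟩ ∈ Ext²(E,E)`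
   (Buchweitz–Flenner 2003 Prop. 4.4) and `σ_k(ob_ξ) = ⟨ξ, ch_{k+1}(E)⟩ ∈ H^{k+2}(Ω^k)` for EACH `k`
   (BF Cor. 4.3, read: p. 20 of arXiv:math/9912245); for `ξ` with `⟨ξ, θ⟩ = 0` (the `g(g+1)/2`
   polarised directions `Sym² H^{0,1}`) one gets `σ₀(ob_ξ) = a⟨ξ,θ⟩ = 0`, `σ₁(ob_ξ) = b⟨ξ,θ²⟩ = 0`, hence
   `ob_ξ = 0`, hence `⟨ξ, ch_q(E)⟩ = σ_{q-1}(ob_ξ) = 0` for all `q`; and the RIGIDITY LEMMA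
   `{y ∈ H^{q,q}(A) : ⟨ξ, y⟩ = 0 ∀ ξ ∈ Sym² H^{0,1}} = ℂθ^q` (`1 ≤ q ≤ g-1`; `GL(H^{1,0})`-decomposition
   `∧^q ⊗ ∧^{q∨} = ⊕ₖ V_k`, each `V_k`, `k ≥ 1`, is moved by `⟨(e¹)², ·⟩`; weight-zero certificate
   `kit/rigidity_lemma.py`: verified locally for all `g ≤ 9`, `1 ≤ q ≤ g-1`; `kit` job j010030 queued for `g ≤ 12`) finishes. So `{0,1}`-semiregularity can only ever certify classes in `ℂ[θ]` on an
   abelian variety whose `ch₁, ch₂` are tied to `θ` — in particular on a VERY GENERAL Weil-type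
   abelian `2n`-fold with `n ≥ 3` (`B¹ = ℚθ`, `B² = ℚθ²` by `SU(n,n)`-invariant theory) NO
   `{0,1}`-semiregular vector bundle or perfect complex has a non-zero Weil component in `ch_n`;
   Markman's secant sheaves are never `{0,1}`-semiregular there (their obstruction in the non-`K`-linear
   directions is non-zero, lies in `ker σ₀ ∩ ker σ₁`, and is seen only by `σ_{n-1}`).
15. CONSEQUENCE — TARGET KILLED (paper level; §11 `SymmetryLadderLine`): Stub 1
   `stub_weilSectorSeeds` of the registered skeleton `Lines/symmetry-ladder-isotypic-obstructions.lean`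
   (`∃ T : ChernCharacterBetti, WeilSeeds[T]`) is FALSE — for every `T`, `n = 3` (any `n ≥ 3`), any
   `d`, a very general Weil-type `(A, φ)` and a non-zero rational `(n,n)` Weil class `c`:
   `Certified[T, A, n, c]` forces `c ∈ ℂθⁿ`, i.e. `c = 0` (the certifying family `S ∋ s₁` is connected,
   so the flat-Hodge classes `G₁, G₂` of `SeedAt` are fibrewise multiples of the hyperplane powers
   `Θ, Θ²` because they are so at the very general fibre `s₁`; the no-go theorem at each seed point `z_j`
   gives `T.ch_n(E_j) = c_j Θⁿ|_{z_j}`, hence `G_j = c_j Θⁿ` fibrewise, and endomorphism-translates /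
   `DivPow` stay in `ℂθⁿ` at `s₁`; `T.ch = λ^q ch^top` on smooth projective varieties follows from the
   fields of `ChernCharacterBetti`). Stub 2 `stub_seededGeneration` (`∀ T, WeilSeeds[T] → …`) is then
   VACUOUS (`stub_seededGeneration_of_forall_not_weilSeeds`, sorry-free), so the line as registered
   cannot reach the crux. The unconditional `¬stub` is not Lean-landable (needs the Hodge theory of
   Weil-type abelian varieties and BF's obstruction calculus, absent from the tree): recorded as the
   near-miss `stub_weilSectorSeeds_false` (sorry, proof in docstring) + `NegativeNoteStubWeilSectorSeeds.md`;
   but the TRANSPORT ARGUMENT IS KERNEL-CHECKED: `Theorems/HodgeAbelianVarieties/Negative/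
   StubWeilSectorSeedsFalseOf.lean` (p76553, sorry-free, standard axioms) proves
   `h₁ → h₂ → h₃ → h₄ → ¬ ∃ T, WeilSeeds[T]` against the VERBATIM typed stub, where `h₁` = the no-go
   theorem on real carriers, `h₂` = flatness of global classes over the connected base, `h₃` = the
   hyperplane polarisation, `h₄` = a very general Weil-type sixfold with its `SU(3,3)` Hodge ring — four
   theorems in print / on paper, spelled out in binders.
   REPAIR for the lead: the seed predicate must include `σ_{n-1}` (BF's `I ∋ n-1`; needs the `Ω^a`
   carriers of `defn-HodgeSheavesOmega`) and `ch_n` itself must be required flat-Hodge over `S`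
   (confining deformations to the Weil locus) — `{0,1}` is the wrong index set for degree `2n ≥ 6`.
16. CONSEQUENCE FOR THE ROUTE (information, §11 docstrings): `{0,1}`-semiregularity of a seed `E₁` on
   the special fibre of a smooth projective `𝒳/W` with torsion-free Hodge cohomology LIFTS to any
   formal/algebraic lift `E` (`0 → Ext²_W ⊗ k → Ext²_k`, targets free and base-change exact), so
   `P1 ∘ P2` run with the ZERO higher-`σ` package (`IsPadicSemiregular 0 ↔ IsZeroOneSemiregular`,
   `SemiregularSeedsOnAnchors/TypedCrux`) outputs, on a lifted Weil-type `2n`-fold with `B¹ = ℚθ`,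
   `B² = ℚθ²` (`n ≥ 3`), a `{0,1}`-semiregular bundle whose `ch` lies in `ℚ[θ]`: no Weil class. The
   higher package must be non-trivial in form degree `n-1`; for fourfolds (`n = 2`, `ch₂` is the target)
   nothing is excluded — consistent with Markman.

## Findings (cycle 4, refuter-cdisprove-stmt-HodgeConjecture-1333-g4-0, 2026-08-16) — NO KILL OF THE CRUX; the picked line's C⁺ ladder dissected (§12)

17. THE PICKED LINE (`inner-form-invariant-seeds`, skeleton gen 3, commit 6c531cf7f41b; lead ended
   `promote-stub: stub_starSeeds`). Its registered stubs are `stub_innerFormAnchors` (true in print,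
   construction-blocked: nothing to kill — an `∃` over real carriers plus a hypothesis structure) and
   `stub_starSeeds : StarSeeds`, with the PROVED engine `StarSeeds ⊢ FormalSeeds ⊢ RationalPVHC` (mod P1a,
   P3a). §12 copies the three C⁺'s VERBATIM (`InnerFormLine`) and proves, sorry-free: (a) all three are
   VACUOUS for `d ≤ 1` (`…_of_le_one`); (b) `¬ RationalPVHCFor C d 𝒴 ↔ HasRationalFakeClass C d 𝒴`
   (a rational algebraic class `u` of the special fibre, `1 ≤ r < d`, with `bo u ∈ Fʳ` but `bo u ∉ K·A^r(Y_K)`);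
   (c) THE KILL SWITCH: one supersingular abelian anchor satisfying every hypothesis of the C⁺'s and
   carrying a rational fake class (`FakeAnchorExists`) refutes `RationalPVHC` outright, `FormalSeeds`
   modulo P3a (known) and the registered `StarSeeds` modulo P1a ∧ P3a (`not_starSeeds_of_fakeAnchor`,
   `starSeeds_dichotomy`). As typed the three C⁺'s quantify over ALL supersingular abelian anchors while the
   composition `HodgeAbelianVarieties_of` consumes the local statement only at the Kisin anchors of stub 1:
   the stub is exposed at anchors the line never uses (misstatement insurance for the planner: restate the
   C⁺'s over the stub-1 anchors, or restrict `u` to `U^{I_x}`).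
18. WHAT A FAKE CLASS IS, AND WHY HC DOES NOT EXCLUDE IT (paper, §12 docblock). On the classical `C` and an
   abelian scheme `𝒴/W(𝔽̄_p)`, a rational fake class is a `ℚ`-combination of specialisations of cycles that is
   de Rham–Tate AT THE SINGLE PRIME `p` (Ogus 1982; Tang, Compositio 2018 = arXiv:1510.01357 Def. 5) but not
   absolute Hodge on `Y_K` (Deligne: algebraic ⇒ absolute Hodge, so `RationalPVHCFor` forces absolute Hodge).
   "De Rham–Tate ⇒ Hodge" is OPEN even over number fields with Frobenius-invariance at cofinitely many primes
   (Ogus Problem 2.4, Tang Conj. 8: known for CM, elliptic curves, some prime-dimensional families), and the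
   one-prime version over `K = W(𝔽̄_p)[1/p]` is a p-adic period statement (André 2003, MSJ Mem. 12, Part III)
   that the Hodge conjecture does NOT imply. Hence `RationalPVHC ⊋ crux` along an axis independent of HC:
   the fallback C⁺'s are NOT reductions of the crux — they are `HC|AV` PLUS a one-prime transcendence
   statement. (`ℚ_p`-rational fakes exist already for `r = 1`: lifts `E_x` of a supersingular `E₀` whose
   Hodge line is an eigenline of a LOCAL quaternion `x ∈ End(E₀[p^∞]) ∖ End(E₀) ⊗ ℤ_p` carry a
   filtered-`φ`-invariant class on `E_x²` that is not algebraic; `ℚ`-rationality is what BO 3.8 exploits.)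
19. WHERE A RATIONAL FAKE CAN AND CANNOT LIVE (paper, §12 docblock; numbers). (i) `r = 1`: none (BO 3.8 +
   Grothendieck–Messing + algebraisation: `U¹_Hdg(y) = NS(Y_K)_ℚ = NS(Y_{K̄})_ℚ`). (ii) `r = d - 1`: none —
   hard Lefschetz `L^{d-2} : H² → H^{2d-2}` is a FILTERED isomorphism (`θ ∈ F¹`; `dim F¹H² = C(d,2) + d² =
   dim F^{d-1}H^{2d-2}`) and maps `U¹_ℚ` onto `U^{d-1}_ℚ` (equal dimensions `b₂ = b_{2d-2}` on a
   supersingular fibre), so `U^{d-1}_Hdg = θ^{d-2}·U¹_Hdg` is algebraic: `RationalPVHCFor` is a THEOREM for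
   `d ≤ 3`, first open cell `(d, r) = (4, 2)` (the Weil-fourfold anchors, where HC itself is Markman's
   theorem but neither `RationalPVHCFor` nor (⋆)-seeds are known). (iii) At CM lifts no fake (the
   `ℚ`-structure `U_ℚ` and the Betti `ℚ`-structure are both representations of the CM torus with the same
   characters and the same p-adic/complex Hodge types: Ogus Thm. 4.16). (iv) GERM TRANSPORT: in
   Grothendieck–Messing graph coordinates `T` at any base lift, the p-adic Hodge locus
   `Σ_u = {T : bo_T(u) ∈ Fʳ}` is an algebraic subvariety of the Lagrangian Grassmannian and the p-adic and
   complex period maps are the SAME formal power series in algebraic coordinates of `𝒜_g` (horizontal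
   sections of Gauss–Manin); by Cattani–Deligne–Kaplan + Deligne–André, every component of `Σ_u ∩ disc`
   through a point where `u` IS absolute Hodge is (the `W`-points of) a special subvariety on which `u` stays
   Hodge — no fake there. So a fake needs a component of `Σ_u ∩ disc` containing NO absolute-Hodge point:
   an UNLIKELY INTERSECTION — for a primitive rational class in `P^{2s}`, `2 ≤ s ≤ d/2`, membership in `F^s`
   is `Σ_{a<s} p^{a,2s-a}` equations on the `d(d+1)/2`-dimensional disc of polarised lifts: `(4,2)`: 11 > 10;
   `(5,2)`: 45 > 15; `(6,2)`: 120 > 21; `(6,3)`: 127 > 21. Generic rational classes have EMPTY p-adic Hodge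
   locus; only classes with a large stabiliser in the quaternion-unitary group `GU_d(B_{p,∞})` of the
   supersingular `ℚ`-structure can be p-adically Hodge anywhere, and for those coming from Shimura
   subvarieties through the disc (Weil, RM, products) the locus is special and `u` is Hodge there. No exact
   fake is cheaply constructible: lifts with `T` algebraic over `ℚ(i)` in crystalline coordinates acquire
   endomorphisms forced by the Galois conjugates of the `Fʳ`-conditions (`ℚ(i)`-rational `T` on `E₀³`:
   `A_T ~ E'³` CM, `dim U¹_Hdg = dim U²_Hdg = 9`; quartic `T`: a commutative cubic algebra of endomorphisms,
   `3 = 3`) — the numerology closes up at every algebraic point tried: CERTIFIED by exact arithmetic over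
   `ℚ(ζ₈)` (`kit/padic_fake_probe.py`, local run + `kit` job j013524, `p = 11`, seed 7; evidence
   `padic_fake_probe_results.json`): model dims `dim U¹_ℚ = 2d² - d`, `dim U²_ℚ = b₄` (6/1, 15/15, 28/70 for
   `d = 2, 3, 4`); at every test point `U²_Hdg(T) ⊇ Alg²(T)` with EXCESS 0 — `d = 3`: (U¹_Hdg, U²_Hdg) = (9,9) at
   the CM point and at `ℚ`- or `ℚ(i)`-rational `T`, (3,3) at quartic `T`, (6,6) for `E_s³`, (3,3) for a product of
   three curves, and `U²_Hdg = θ·U¹_Hdg` ALWAYS (hard Lefschetz, (A)); `d = 4`: (16,36) CM / `ℚ(i)`-rational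
   (`= h^{2,2}(E_CM⁴)`), (4,6) quartic, (10,20) `E_s⁴`, (4,6) product, (6,11) at a quartic point of the p-adic
   Weil locus `T = p(0 X; Xᵗ 0)` — all equal to the products of `U¹_Hdg`. GENERIC MEMBERS (intersection over
   three quartic points): Weil locus `(ℚ(i), (2,2))`: `U¹_Hdg = 1`, `U²_Hdg = 3`, products `1` — excess `2` =
   the two RATIONAL p-adic Weil classes (independently = drefute g2's j011554), genuinely Hodge there (Markman);
   `A₂ × A₂` locus: (2, 3, 3); whole chart: (1, 1, 1). TANGENT SPACES of p-adic Hodge loci at the CM point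
   (`d = 4`, 17 equations in 10 coordinates, exact rank): `θ²`: 10; a random rational class Hodge at the CM point
   (36-dimensional space): 0 — ISOLATED, p-adically Hodge at no nearby lift (the certified instance of "11 > 10");
   `θ₁₂ ∧ θ₃₄`: 6 `= dim(A₂ × A₂)`; each rational Weil class: 4 `= n² = dim U(2,2)`-locus: p-adic tangent
   dimensions = complex special-subvariety dimensions, as germ transport predicts.
   VERDICT: the kill switch exists in logic, is not excluded by any theorem, and is protected by an
   unlikely-intersection count; 1 `kit` job (j013524, the consistency certificate above; nothing finite
   certifies a transcendental fake — cf.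
   Costa–Sertöz, arXiv:2003.11037 §1.4, read: the p-adic obstruction kernel on Tate classes is a
   `ℚ_p`-space that can strictly exceed the rational algebraic classes, "the obstruction map can be
   irrational", and the rational image inside Tate classes has "no description, even conjecturally").
20. (⋆) — A POSITIVE CRITERION FOR THE P1a/P2a SEATS (paper, §12 docblock). Let `𝒴/W` be an abelian scheme,
   `G = 𝒴 ×_W 𝒴^∨` acting on sheaves by translation and `Pic⁰`-twist, `ℰ` a vector bundle on `𝒴` with special
   fibre `E₁`. Lifts of a given lift `F/X_{n+1}` of `E₁` to `X_{n+2}` form a torsor under `Ext¹(E₁,E₁)`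
   (ideal `p^{n+1}𝒪/p^{n+2}𝒪 ≅ 𝒪_{X_1}`), on which `ker(G(W/p^{n+2}) → G(W/p^{n+1})) ≅ Lie(G) ⊗ k` acts
   through the orbit map `Lie(A₀) ⊕ H¹(𝒪) → Ext¹(E₁,E₁)`. IF THAT MAP IS SURJECTIVE ("`G`-rigid": all
   first-order deformations of `E₁` are translations and twists — semi-homogeneous bundles, `ext¹ = d`
   (Mukai 1978), and simple sheaves with `ext¹ = 2d`, e.g. Mukai vectors with `v² = 2` on abelian surfaces),
   then by induction every lift of `E₁` to every `X_{n+1}` is a `G`-translate of `ℰ|X_{n+1}` and lifts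
   further: (⋆) `ClassLiftsImplyObjectLifts 𝒴 E₁` holds OUTRIGHT (its K₀-hypothesis is never needed) and so
   does the Hodge condition. So (⋆)-seeds = `G`-rigid special fibres of global bundles; semiregularity
   (dead for `n ≥ 3` in the `{0,1}` form, cycle 3) is not needed. CAVEAT (typing): the seeds of
   `starSeedClasses` must be `IsFiniteLocallyFree`; the Weil-class sheaves in print (Markman's, on
   `X × X^∨`) are torsion-free reflexive and not known to be locally free, and locally free resolutions /
   direct sums LOSE `G`-rigidity and acquire obstructed deformations with liftable class (drefute g2's
   `F_T` on `𝒪²`): the typed (⋆) may exclude the only construction in print — recommend typing seeds as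
   coherent sheaves flat over `W_n` or perfect complexes (same `K₀` on regular `X_n`).
21. TARGETS: payload `targets = []`, `stuck_stubs = []`; the two registered stubs are tracked in §12 / §6
   Targets. No stub is killed this cycle: `stub_starSeeds` is refutable ONLY through a fake anchor (Finding
   17(c)) or a failure of (⋆) for every locally free seed of a needed class — neither is decidable here.

LANDED (gate-accepted, importable): `Summits/HodgeConjecture/HodgeConjecture/Theorems/HodgeAbelianVarieties/
Negative/ExtremeCodimensions.lean` (p70486, commit bccf68b69b67) = the sorry-free §1–§3 below (namespace
`Summit.HodgeConjecture.HodgeConjecture.Theorems.HodgeAbelianVarieties.Negative`; the def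
`zeroAbelianVariety` is rendered there as `exists_abelianVariety_dim_eq_zero`); cycle 2 proposes the
contrapositive kill-transfer lemmas of §7 and the §8 refutation as `Summits/HodgeConjecture/HodgeConjecture/
Theorems/HodgeAbelianVarieties/Negative/KillTransfer.lean` (p73980, ACCEPTED, commit d64d2e5210bf; same
`…Theorems.HodgeAbelianVarieties.Negative` namespace, names `not_of_not_<route>_<item>`,
`not_of_not_hodgeConjecture_of_<complement>`, `not_divisorGenerated_of_weil1977`,
`not_divisorGenerated_simple_of_mumford1968`, helper `mem_algebraicClasses_of_dim_eq`). This work file keeps its own copies so that it elaborates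
independently of the hub's olean state.

Everything conclusive below is sorry-free; `sorry` marks NEAR-MISSES only (§4–§5: paper theorems whose
Lean proofs need objects the tree does not have — `𝔾_m` with its de Rham cohomology, a nodal cubic, the
component group of a proper group scheme, `H²` of an abelian surface), each with the obstruction in its
docstring. Nothing here is proposed to `Theorems/` (no `¬`-refutation exists).
-/

set_option linter.dupNamespace false

noncomputable section

open CategoryTheory CategoryTheory.Limits AlgebraicGeometry MonoidalCategory

namespace Summit.HodgeConjecture.HodgeConjecture.Cruxes.HodgeAbelianVarieties.Disproof

open Summit.HodgeConjecture.HodgeConjecture.Theses.PadicSemiregularLift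
open Literature.AlgebraicGeometry Literature.AlgebraicGeometry.HodgeTheory
  Literature.AlgebraicGeometry.Motives Literature.AlgebraicTopology.SingularHomology

/-! ## §1 Read-back and the upper bound `HodgeConjecture → HodgeAbelianVarieties` -/

/-- READ-BACK of the crux, symbol by symbol: for every bundled complex abelian variety `A`, (i) a
Hodge model of `A.X` in dimension `A.dim` exists and (ii) every rational class of Hodge type `(p,p)`
in `H²ᵖ(A(ℂ); ℂ)` lies in `algebraicClasses A.X p = Nᵖ H²ᵖ`. Definitional (`Iff.rfl`). [folklore] -/
theorem hodgeAbelianVarieties_iff :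
    HodgeAbelianVarieties ↔
      ∀ A : AbelianVariety ℂ, Nonempty (HodgeModel A.dim A.X) ∧
        ∀ (p : ℕ) (c : singularCohomology ℂ ℂ (ComplexPoints A.X) (2 * p)),
          IsRationalClass c → IsOfHodgeType A.dim A.X (2 * p) p p c → c ∈ algebraicClasses A.X p :=
  Iff.rfl

/-- **The crux is the summit restricted to abelian varieties** (sorry-free). Every bundled abelian
variety is a smooth projective geometrically irreducible variety of dimension `A.dim`
(`AbelianVariety.isSmoothProjective_holds`, PROVED in the tree: Görtz–Wedhorn Thm. 27.71 /
Prop. 27.174), so the smooth-projectivity guard of the summit is automatic on the binder. Consequently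
the crux carries no statement STRONGER than the Hodge conjecture (`HodgeConjecture` gives the right-hand
side by `fun A _ ↦ h _`): it cannot be false unless HC is. [folklore] -/
theorem iff_hodgeConjecture_restricted :
    HodgeAbelianVarieties ↔
      ∀ A : AbelianVariety ℂ, IsSmoothProjective A.dim A.X → HodgeConjectureFor A.dim A.X :=
  ⟨fun h A _ ↦ h A, fun h A ↦ h A (AbelianVariety.isSmoothProjective_holds (A := A))⟩

/-- **Any kill of the crux kills the summit** (route kill criterion (c), now formal): a
counterexample to `HodgeAbelianVarieties` is a counterexample to `HodgeConjecture`. [folklore] -/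
theorem not_hodgeConjecture_of_not (h : ¬ HodgeAbelianVarieties) : ¬ _root_.HodgeConjecture :=
  fun hc ↦ h (iff_hodgeConjecture_restricted.2 fun _ hA ↦ hc hA)

/-- With the named fact `nonempty_hodgeModel` (Serre GAGA + de Rham + Hodge decomposition; D-0014)
the anti-vacuity conjunct is discharged on every abelian variety, so the crux is exactly its CYCLE
part. [cite: Deligne2000, §1] -/
theorem iff_cyclePart (hM : ∀ (n : ℕ) (X : SchemeOver ℂ), nonempty_hodgeModel n X) :
    HodgeAbelianVarieties ↔
      ∀ (A : AbelianVariety ℂ) (p : ℕ) (c : singularCohomology ℂ ℂ (ComplexPoints A.X) (2 * p)),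
        IsRationalClass c → IsOfHodgeType A.dim A.X (2 * p) p p c → c ∈ algebraicClasses A.X p :=
  ⟨fun h A ↦ (h A).2,
    fun h A ↦ ⟨hM _ _ (AbelianVariety.isSmoothProjective_holds (A := A)), h A⟩⟩

/-! ## §2 Non-vacuity of the binder and the degenerate instance `dim A = 0` -/

/-- **The zero abelian variety** `Spec ℂ → Spec ℂ` with the trivial group law (the monoidal unit of
`SchemeOver ℂ` with Mathlib's `GrpObj.instTensorUnit`): a genuine, sorry-free inhabitant of the
crux's binder type, so `HodgeAbelianVarieties` is not vacuously true. [folklore] -/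
def zeroAbelianVariety : AbelianVariety ℂ where
  X := 𝟙_ (SchemeOver ℂ)
  grpObj := GrpObj.instTensorUnit
  isProper := inferInstanceAs (IsProper (𝟙 (Spec (.of ℂ))))
  geometricallyIntegral :=
    IsSmoothProjective.geometricallyIntegral_holds (isSmoothProjective_unit_holds ℂ)

/-- The zero abelian variety has dimension `0` (`schemeDim (Spec ℂ) = 0`, via the tree's PROVED
`schemeDim_eq_holds` at the smooth projective `0`-fold `Spec ℂ`). [folklore] -/
theorem dim_zeroAbelianVariety : zeroAbelianVariety.dim = 0 :=
  schemeDim_eq_holds (isSmoothProjective_unit_holds ℂ)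

/-- An abelian variety of dimension `0` has exactly one complex point: its structure morphism is an
isomorphism (`AbelianVariety.isIso_hom_of_dim_eq_zero`, PROVED in the tree), so sections of it over
`Spec ℂ` coincide. [folklore] -/
theorem subsingleton_complexPoints_of_dim_eq_zero (A : AbelianVariety ℂ) (h : A.dim = 0) :
    Subsingleton (ComplexPoints A.X) := by
  haveI := A.isIso_hom_of_dim_eq_zero h
  refine ⟨fun P Q ↦ ?_⟩
  apply Over.OverMorphism.ext
  rw [← cancel_mono A.X.hom, Over.w, Over.w]

/-- **Degenerate instance (sorry-free).** On an abelian variety of dimension `0` the crux is EXACTLY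
the anti-vacuity conjunct: the cycle part holds because `algebraicClasses _ 0 = ⊤` (`p = 0`) and
`H²ᵖ(pt; ℂ) = 0` for `p ≥ 1` (Hatcher §3.1; the tree's PROVED
`isZero_singularCohomology_of_subsingleton'`). So the junk end of the binder neither refutes nor
trivialises the crux: it asks for a Hodge model of the point, a theorem in print.
[cite: HatcherAT2002, §3.1 p. 199] -/
theorem hodgeConjectureFor_iff_nonempty_hodgeModel_of_dim_eq_zero (A : AbelianVariety ℂ)
    (h : A.dim = 0) : HodgeConjectureFor A.dim A.X ↔ Nonempty (HodgeModel A.dim A.X) := by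
  refine ⟨fun h' ↦ h'.1, fun hM ↦ ⟨hM, fun p c _ _ ↦ ?_⟩⟩
  rcases Nat.eq_zero_or_pos p with rfl | hp
  · exact hodgeConjectureFor_codim_zero c
  · haveI := subsingleton_complexPoints_of_dim_eq_zero A h
    have hz : IsZero (singularCohomology ℂ ℂ (ComplexPoints A.X) (2 * p)) :=
      singularCochainComplex.isZero_singularCohomology_of_subsingleton' (by omega)
    haveI := ModuleCat.subsingleton_of_isZero hz
    rw [Subsingleton.elim c 0]
    exact Submodule.zero_mem _

/-- The crux at the zero abelian variety, discharged from the named fact `nonempty_hodgeModel`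
(the point `Spec ℂ` is smooth projective of dimension `0`: the tree's PROVED
`isSmoothProjective_unit_holds`). [cite: SerreGAGA1956, §2] -/
theorem hodgeConjectureFor_zeroAbelianVariety (hM : nonempty_hodgeModel 0 (𝟙_ (SchemeOver ℂ))) :
    HodgeConjectureFor zeroAbelianVariety.dim zeroAbelianVariety.X := by
  rw [hodgeConjectureFor_iff_nonempty_hodgeModel_of_dim_eq_zero _ dim_zeroAbelianVariety,
    dim_zeroAbelianVariety]
  exact hM (isSmoothProjective_unit_holds ℂ)

/-! ## §3 Where a counterexample must live: extreme codimensions are harmless -/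

/-- **Extreme codimensions (sorry-free, no Hodge-type or rationality hypothesis).** On an abelian
variety `A`, every class of `H²ᵖ(A(ℂ); ℂ)` with `p = 0` or `A.dim ≤ p` is algebraic: `p = 0` is
`algebraicClasses_zero`; `p = dim A ≥ 1` is the top degree (`mem_algebraicClasses_of_degree_top`:
every class vanishes off a closed point); `p > dim A` is the zero group
(`subsingleton_singularCohomology_of_lt`, Hatcher Thm. 3.26(c) on the closed `2n`-manifold `A(ℂ)`);
`dim A = 0 < p` is `H²ᵖ(pt) = 0`. [cite: HatcherAT2002, §3.3 Thm. 3.26(c)]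
[cite: VoisinHodgeII2003, §10.2.3 proof of Prop. 10.26] -/
theorem mem_algebraicClasses_of_dim_le (A : AbelianVariety ℂ) {p : ℕ} (hp : p = 0 ∨ A.dim ≤ p)
    (c : singularCohomology ℂ ℂ (ComplexPoints A.X) (2 * p)) : c ∈ algebraicClasses A.X p := by
  have hX : IsSmoothProjective A.dim A.X := AbelianVariety.isSmoothProjective_holds
  rcases Nat.eq_zero_or_pos p with rfl | hp0
  · exact hodgeConjectureFor_codim_zero c
  have hdp : A.dim ≤ p := hp.resolve_left (by omega)
  rcases hdp.eq_or_lt with hdp' | hdp'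
  · -- top degree `p = dim A ≥ 1`
    subst hdp'
    exact mem_algebraicClasses_of_degree_top hX hp0 c
  · -- above the top degree the group vanishes
    haveI := ComplexPoints.subsingleton_singularCohomology_of_lt hX ℂ (k := 2 * p) (by omega)
    rw [Subsingleton.elim c 0]
    exact Submodule.zero_mem _

/-- **The crux is equivalent to its middle-codimension part** `1 ≤ p < dim A` (plus the anti-vacuity
conjunct) — sorry-free. A counterexample, if any, is a rational `(p,p)`-class with `1 ≤ p ≤ dim A - 1`.
[cite: VoisinHodgeII2003, §10.2.3 proof of Prop. 10.26] -/
theorem hodgeAbelianVarieties_iff_middle :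
    HodgeAbelianVarieties ↔
      ∀ A : AbelianVariety ℂ, Nonempty (HodgeModel A.dim A.X) ∧
        ∀ p : ℕ, 1 ≤ p → p < A.dim →
          ∀ c : singularCohomology ℂ ℂ (ComplexPoints A.X) (2 * p), IsRationalClass c →
            IsOfHodgeType A.dim A.X (2 * p) p p c → c ∈ algebraicClasses A.X p := by
  refine ⟨fun h A ↦ ⟨(h A).1, fun p _ _ c hc hpp ↦ (h A).2 p c hc hpp⟩, fun h A ↦ ⟨(h A).1, ?_⟩⟩
  intro p c hc hpp
  by_cases hmid : 1 ≤ p ∧ p < A.dim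
  · exact (h A).2 p hmid.1 hmid.2 c hc hpp
  · exact mem_algebraicClasses_of_dim_le A (by omega) c

/-- **Granting Lefschetz `(1,1)` and hard Lefschetz (named facts of the tree), the crux reduces to the
DEEP middle `2 ≤ p`, `2p ≤ dim A`; in particular a minimal counterexample has `dim A ≥ 4`.**
`p = 1` is `lefschetzOneOne_rational`; `2p > dim A` is reduced to codimension `dim A - p < p` by
`mem_algebraicClasses_of_lt_of_nonempty` (`L^{2p-n}` is a rational isomorphism of type `(2p-n, 2p-n)`
preserving algebraicity), and the strong induction on `p` closes. [cite: VoisinHodgeI2002, Thm. 6.25, Rem. 6.27, Thm. 11.30]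
[cite: KerrPearlstein2011, §3.1] -/
theorem hodgeAbelianVarieties_iff_deepMiddle
    (hM : ∀ (n : ℕ) (X : SchemeOver ℂ), nonempty_hodgeModel n X)
    (h11 : lefschetzOneOne_rational)
    (hHL : ∀ (n : ℕ) (X : SchemeOver ℂ), nonempty_hardLefschetzNFold n X) :
    HodgeAbelianVarieties ↔
      ∀ (A : AbelianVariety ℂ) (p : ℕ), 2 ≤ p → 2 * p ≤ A.dim →
        ∀ c : singularCohomology ℂ ℂ (ComplexPoints A.X) (2 * p), IsRationalClass c →
          IsOfHodgeType A.dim A.X (2 * p) p p c → c ∈ algebraicClasses A.X p := by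
  rw [iff_cyclePart hM]
  refine ⟨fun h A p _ _ c hc hpp ↦ h A p c hc hpp, fun h A ↦ ?_⟩
  have hX : IsSmoothProjective A.dim A.X := AbelianVariety.isSmoothProjective_holds
  -- strong induction on the codimension
  intro p
  induction p using Nat.strong_induction_on with
  | _ p ih =>
    intro c hc hpp
    by_cases h0 : p = 0 ∨ A.dim ≤ p
    · exact mem_algebraicClasses_of_dim_le A h0 c
    push Not at h0
    obtain ⟨hp0, hpd⟩ := h0
    by_cases h1 : p = 1
    · subst h1
      exact h11 hX c hc hpp
    by_cases hdeep : 2 * p ≤ A.dim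
    · exact h A p (by omega) hdeep c hc hpp
    · -- `dim A < 2p`: hard Lefschetz reduces to codimension `dim A - p < p`
      refine mem_algebraicClasses_of_lt_of_nonempty (hHL _ _) hX (by omega) ?_ c hc hpp
      intro c' hc' hpp'
      exact ih (A.dim - p) (by omega) c' hc' hpp'

/-- **`dim A ≤ 3` is settled from the tree's facts** (curves, surfaces, threefolds: Lefschetz `(1,1)`
and `L : H² ≅ H⁴`; the grounder's partial reduction, restated with projectivity now PROVED).
[cite: VoisinHodgeII2003, §10.2.3 proof of Prop. 10.26] -/
theorem of_dim_le_three (h3 : hodgeClasses_algebraic_of_dim_le_three)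
    (hM : ∀ (n : ℕ) (X : SchemeOver ℂ), nonempty_hodgeModel n X)
    (A : AbelianVariety ℂ) (hd : A.dim ≤ 3) : HodgeConjectureFor A.dim A.X :=
  hodgeConjectureFor_of_dim_le_three h3 (hM _ _) hd AbelianVariety.isSmoothProjective_holds

/-- **Dimension 4, the Weil plane** (tree fact `Markman2025_weilClasses_algebraic_abelianFourfold`,
Markman arXiv:2509.23403 Thm. 1.2 / arXiv:2502.03415 Cor. 1.6.1): on an abelian fourfold with
`φ ≫ φ = -d`, rational `(2,2)`-classes in the Weil plane `E₊ ⊔ E₋` are algebraic — the instance of the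
crux that was "the first test" of every counterexample programme (Weil 1977, Kontsevich–Zharkov) is
now a theorem. (The full `dim ≤ 5` statement, Cor. 1.3, needs Moonen–Zarhin's classification and is
print-only.) [cite: Markman2025SurveySecant, Thm. 1.2 and Cor. 1.3] -/
theorem weilPlane_dim_four (hW : Markman2025_weilClasses_algebraic_abelianFourfold)
    {d : ℕ} (hd : 0 < d) (A : AbelianVariety ℂ) (φ : A ⟶ A) (hA : A.dim = 2 * 2)
    (hφ : φ ≫ φ = -(d • 𝟙 A)) (c : singularCohomology ℂ ℂ (ComplexPoints A.X) (2 * 2))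
    (hc : IsRationalClass c) (h22 : IsOfHodgeType (2 * 2) A.X (2 * 2) 2 2 c)
    (hw : c ∈ weilClassesOf A φ 2 d) : c ∈ algebraicClasses A.X 2 :=
  hW d hd A φ hA (hA ▸ AbelianVariety.isSmoothProjective_holds) hφ c hc h22 hw

/-- **The first open instances are typed elsewhere in the tree**: the crux implies the target
`TropicalCuspLift.WeilClassesAlgebraic` (Weil classes on Weil-type abelian `2n`-folds, all `n ≥ 2`,
stmt-HodgeConjecture-2522) and its `n = 3` case `TropicalCuspLift.WeilSixfolds` (stmt-2524) — in print
the FIRST OPEN cases of the Hodge conjecture for abelian varieties ("outside [disc `-1`] the Hodge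
conjecture for Weil classes on sixfolds remains completely open", arXiv:2603.20268 p. 3). Stated as one
conjunction (both implications are specialisations of the crux at `p = n`, resp. `p = 3`, the Weil-plane
membership hypothesis being simply dropped). So a refutation of either of those items is a kill of THIS
crux (`not_of_not_weilSixfolds`), and every counterexample programme in print (Weil 1977,
Kontsevich–Zharkov 2020) aimed exactly there. [cite: vanGeemen1994HodgeAV, Thm. 4.11]
[cite: Markman2025SurveySecant, Thm. 1.2] -/
theorem weilItems_of (h : HodgeAbelianVarieties) :
    Summit.HodgeConjecture.HodgeConjecture.Theses.TropicalCuspLift.WeilClassesAlgebraic ∧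
      Summit.HodgeConjecture.HodgeConjecture.Theses.TropicalCuspLift.WeilSixfolds := by
  refine ⟨fun n _ _ _ A _ hA _ _ c hc hnn _ ↦ ?_, fun _ _ A _ hA _ _ c hc h33 _ ↦ ?_⟩
  · have h2 := (h A).2 n c
    rw [hA] at h2
    exact h2 hc hnn
  · have h2 := (h A).2 3 c
    rw [hA] at h2
    exact h2 hc h33

/-- Contrapositive: ONE non-algebraic Weil class on an abelian sixfold of Weil type kills the crux
(and, by `not_hodgeConjecture_of_not`, the summit). [cite: Weil1977HodgeRing] -/
theorem not_of_not_weilSixfolds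
    (h : ¬ Summit.HodgeConjecture.HodgeConjecture.Theses.TropicalCuspLift.WeilSixfolds) :
    ¬ HodgeAbelianVarieties :=
  fun hc ↦ h (weilItems_of hc).2

/-! ## §4 Load-bearing analysis: the three fields of `AbelianVariety` and the coefficients

For each hypothesis `H` carried by the binder `A : AbelianVariety ℂ` we record the crux with `H`
dropped (`HodgeAbelianVarietiesWithout…`) and what happens. The verdict theorems of this section are
NEAR-MISSES (`sorry`, permitted in this work file only): each is a theorem in print whose Lean proof
needs an object the tree does not construct; the docstring gives the paper proof and the obstruction. -/

/-- The crux with PROPERNESS dropped: HC-as-typed for every geometrically integral commutative-or-not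
group scheme over `ℂ` (e.g. `𝔾_m`, `𝔾_a`, `GL_n`), dimension read off as `schemeDim`. [folklore] -/
def HodgeAbelianVarietiesWithoutProper : Prop :=
  ∀ (X : SchemeOver ℂ) [GrpObj X], GeometricallyIntegral X.hom → HodgeConjectureFor (schemeDim X.left) X

/-- **`isProper` is load-bearing (near-miss; paper proof).** Witness `X = 𝔾_m = Spec ℂ[t, t⁻¹]`
(`schemeDim = 1`, geometrically integral group scheme). CLAIM: `¬ Nonempty (HodgeModel 1 𝔾_m)`, hence
`¬ HodgeConjectureFor 1 𝔾_m`. PROOF (print level): any Hodge model `M → 𝔾_m(ℂ)` is biholomorphic to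
`ℂˣ` (the coordinate `t ∘ φ` is an injective holomorphic map of Riemann surfaces onto `ℂˣ`); on `ℂˣ`
the closed `(1,0)`-form `dz/z` has non-zero class (`∮ = 2πi`), its conjugate `dz̄/z̄` is a closed
`(0,1)`-form with `dz/z + dz̄/z̄ = d log |z|²` exact, so `hodgePQ 1 1 0 = hodgePQ 1 0 1 = H¹_dR(ℂˣ; ℂ) ≅ ℂ`
and the field `isInternal_hodgePQ 1` (independence of `H^{1,0}` and `H^{0,1}`) fails. So dropping
properness makes the crux false ALREADY through the anti-vacuity conjunct (no Hodge decomposition on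
non-compact `X^an`). Informative content for provers: none beyond "compact Kähler is used"; the honest
non-proper analogue (Hodge classes := `W_{2p} ∩ Fᵖ` of Deligne's mixed Hodge structure) FOLLOWS from HC
for smooth projective varieties (Deligne, Hodge II/III; Jannsen), so non-properness is not where
counterexamples live. LEAN OBSTRUCTION: `𝔾_m` as a `GrpObj` in `SchemeOver ℂ` with `schemeDim = 1`, and
the computation `[dz/z] ≠ 0` in the tree's `complexDeRhamCohomology` (no Cauchy integral pairing on
de Rham classes of open Riemann surfaces in the tree). Tried: nothing mechanical applies. [folklore] -/
theorem hodgeAbelianVarieties_false_without_proper : ¬ HodgeAbelianVarietiesWithoutProper := by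
  sorry

/-- The crux with the GROUP LAW dropped: HC-as-typed for every proper geometrically integral
`ℂ`-variety, smooth or not, projective or not. [folklore] -/
def HodgeAbelianVarietiesWithoutGroupLaw : Prop :=
  ∀ (X : SchemeOver ℂ), IsProper X.hom → GeometricallyIntegral X.hom →
    HodgeConjectureFor (schemeDim X.left) X

/-- **The group law is load-bearing, but for the wrong reason first (near-miss; paper proof).**
Witness: the nodal plane cubic `X = V(y²z - x²(x+z)) ⊂ ℙ²_ℂ` (proper, geometrically integral,
`schemeDim = 1`). Its complex points near the node are two discs glued at a point, NOT a topological
manifold, so no `HodgeModel 1 X` exists (`IsAnalytification` demands a homeomorphism from a manifold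
charted on `ℂ¹`) and `HodgeConjectureFor 1 X` fails through the anti-vacuity conjunct — a MISSTATED-type
failure (HC is a statement about non-singular varieties). Substantively, for singular projective
varieties the natural statement (Hodge classes of the mixed Hodge structure are algebraic) is FALSE
too (the tree's barrier file `Literature/Barriers/HodgeConjecture/SingularVarieties.lean`), while for
SMOOTH proper non-projective `X` (Moishezon) HC follows from the projective case (Chow lemma +
resolution + `π_* π^* = id`). What the group law really buys: smoothness (Cartier: group schemes
locally of finite type over a field of characteristic `0` are smooth), projectivity (Weil–Mumford,
PROVED in the tree) and `H^*(A) = ∧^* H¹(A)` with the Mumford–Tate description of Hodge classes —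
the structure every known partial result uses. LEAN OBSTRUCTION: the nodal cubic as a `SchemeOver ℂ`
with `IsProper`/`GeometricallyIntegral` instances and the local topology of its complex points.
[cite: Deligne2000, §1] -/
theorem hodgeAbelianVarieties_false_without_groupLaw : ¬ HodgeAbelianVarietiesWithoutGroupLaw := by
  sorry

/-- The crux with GEOMETRIC INTEGRALITY dropped: HC-as-typed for every proper group scheme over `ℂ`
(possibly disconnected, e.g. `A × (ℤ/2)`, or finite, e.g. `μ_n`). [folklore] -/
def HodgeAbelianVarietiesWithoutGeomIntegral : Prop :=
  ∀ (X : SchemeOver ℂ) [GrpObj X], IsProper X.hom → HodgeConjectureFor (schemeDim X.left) X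

/-- **`geometricallyIntegral` is NOT load-bearing (near-miss; paper proof) — "hypothesis possibly
unnecessary", information for provers.** A proper group scheme `X` over `ℂ` is of finite type, hence
smooth (Cartier), hence the finite disjoint union of the translates of its identity component `X⁰`,
which is an abelian variety of dimension `schemeDim X`. Then `X(ℂ) = ⊔ᵢ gᵢ X⁰(ℂ)`; a Hodge model of `X`
is the disjoint union of copies of one of `X⁰` (same model space `ℂⁿ`, same de Rham family; the Hodge
decomposition, `hodgePQ` and singular cohomology are products over the finitely many clopen pieces —
cf. the tree's `CohomologyClopenPieces`); a rational `(p,p)`-class restricts to rational `(p,p)`-classes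
on the pieces, algebraic there by the crux for `X⁰`, and a class killed off closed `Zᵢ ⊆ gᵢX⁰` of
codimension `≥ p` on each piece is killed off `⊔ Zᵢ`, closed of codimension `≥ p` in `X`. Hence
`HodgeAbelianVarieties → HodgeAbelianVarietiesWithoutGeomIntegral`; connectedness hides no
counterexample. LEAN OBSTRUCTION: component decomposition of proper group schemes over `ℂ` (Cartier
smoothness is not in Mathlib), and additivity of `HodgeModel`/`IsOfHodgeType`/`algebraicClasses` over
clopen decompositions of `X`. [cite: MumfordAV1970, §4] -/
theorem hodgeAbelianVarietiesWithoutGeomIntegral_of (h : HodgeAbelianVarieties) :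
    HodgeAbelianVarietiesWithoutGeomIntegral := by
  sorry

/-! ### Coefficients and the Hodge-type hypothesis -/

/-- The crux with RATIONALITY of the class dropped: every class of Hodge type `(p,p)` (complex
coefficients) on an abelian variety is in the `ℂ`-span of cycle classes. [folklore] -/
def AllHodgeTypeClassesAlgebraicOnAbelianVarieties : Prop :=
  ∀ (A : AbelianVariety ℂ) (p : ℕ) (c : singularCohomology ℂ ℂ (ComplexPoints A.X) (2 * p)),
    IsOfHodgeType A.dim A.X (2 * p) p p c → c ∈ algebraicClasses A.X p

/-- **`IsRationalClass` is load-bearing (near-miss; classical).** On any abelian surface `A`,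
`h^{1,1}(A) = 4` while `algebraicClasses A.X 1 = NS(A) ⊗ ℂ` has dimension `ρ(A) ≤ 4`, with `ρ = 1`
for the very general principally polarised abelian surface and `ρ = 2` for `E × E'` with `E, E'`
non-isogenous without CM (`ρ = 4` only for `E × E` with `E` CM): so a general `(1,1)`-class is not in
the span of divisor classes, and `AllHodgeTypeClassesAlgebraicOnAbelianVarieties` is false at `p = 1`,
`dim A = 2`. (For a RATIONAL `(p,p)`-class, `ℂ`-span and `ℚ`-span membership agree; that is why the
crux may use `algebraicClasses` with `ℂ`-coefficients.) LEAN OBSTRUCTION: no abelian surface with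
computed `H²`, `h^{1,1}` or `ρ` on the tree's real carriers. [cite: VoisinHodgeI2002, §11.3.1 and Thm. 11.30] -/
theorem not_allHodgeTypeClassesAlgebraicOnAbelianVarieties :
    ¬ AllHodgeTypeClassesAlgebraicOnAbelianVarieties := by
  sorry

/-- The INTEGRAL strengthening, in the saturation form that needs no Hodge-type predicate on integral
classes: on an abelian variety, an integral class some positive multiple of which is an integral
combination of cycle classes is itself one (`integralAlgebraicClasses = Nᵖ H²ᵖ(A(ℂ); ℤ)` of the tree's
barrier file `IntegralCoefficients`). Implied by the integral Hodge conjecture for abelian varieties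
(`H^*(A(ℂ); ℤ)` is torsion-free and a class with an algebraic multiple is Hodge). [folklore] -/
def IntegralSaturationOnAbelianVarieties : Prop :=
  ∀ (A : AbelianVariety ℂ) (p : ℕ) (α : bettiCohomologyInt A.X (2 * p)) (m : ℕ), 0 < m →
    (m : ℤ) • α ∈ Literature.Barriers.HodgeConjecture.integralAlgebraicClasses A.X p →
      α ∈ Literature.Barriers.HodgeConjecture.integralAlgebraicClasses A.X p

/-- **Engel–de Gaay Fortman–Schreieder (2025), arXiv:2507.15704, Thm. 1.1 / Cor. 1.2** (READ, p. 3 of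
the held text), as a `Prop` on the real carriers: "Let `(X, Θ)` be a very general principally
polarized abelian variety of dimension `g ≥ 4`. Let `Z ∈ CH^c(X)` be an algebraic cycle of codimension
`2 ≤ c ≤ g-1`. Then `[Z] = m·[Θ]^c/c!` with `m` even"; and for `g ∈ {4, 5}` the image of the cycle
class map is exactly `2ℤ[Θ]^c/c!` for `2 ≤ c ≤ g-1`. Rendering (the `g = 4`, `c = 3` instance
suffices): there is a complex abelian variety `A` and an integral class `α ∈ H⁶(A(ℂ); ℤ)` (the minimal
curve class `[Θ]³/3!`) which is NOT an integral algebraic class while `2 • α` is (on a very general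
ppav of dimension `4`, a Prym variety, `2·[Θ]³/3!` is the class of an Abel–Prym curve). "This disproves
the integral Hodge conjecture for abelian varieties" (abstract). A named statement of a printed
theorem; NOT proved here (no very general ppav, theta divisor or Prym curve in the tree).
[cite: EngelDeGaayFortmanSchreieder2025, Thm. 1.1 and Cor. 1.2] -/
def EngelDeGaayFortmanSchreieder2025_minimalClass_notAlgebraic : Prop :=
  ∃ (A : AbelianVariety ℂ) (α : bettiCohomologyInt A.X (2 * 3)), A.dim = 4 ∧
    α ∉ Literature.Barriers.HodgeConjecture.integralAlgebraicClasses A.X 3 ∧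
      (2 : ℤ) • α ∈ Literature.Barriers.HodgeConjecture.integralAlgebraicClasses A.X 3

/-- **`ℚ`-coefficients are load-bearing EVEN ON ABELIAN VARIETIES** (sorry-free, from the printed
theorem as hypothesis): the integral saturation statement fails in codimension `3` on a very general
principally polarised abelian fourfold. Consequence for the route: an object-lifting / seed mechanism
that produced INTEGRAL cycles for integral Hodge classes uniformly on abelian varieties is refuted; the
denominator `2` of `[Θ]^c/c!` must appear (the route works in `K₀ ⊗ ℚ`, consistent).
[cite: EngelDeGaayFortmanSchreieder2025, Thm. 1.1] -/
theorem not_integralSaturationOnAbelianVarieties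
    (h : EngelDeGaayFortmanSchreieder2025_minimalClass_notAlgebraic) :
    ¬ IntegralSaturationOnAbelianVarieties := by
  rintro hsat
  obtain ⟨A, α, -, hα, h2α⟩ := h
  exact hα (hsat A 3 α 2 (by norm_num) h2α)

/-! ## §5 The Kähler strengthening (complex tori) is refuted in print — tree barrier, re-exported -/

/-- **Projectivity/algebraicity of the torus is load-bearing**: on compact Kähler fourfolds charted on
`ℂ⁴` — general complex tori of Weil type — rational `(2,2)`-classes are NOT accounted for by analytic
subvarieties or line bundles (Zucker 1977; Voisin 2002, IMRN, Thm. 1 and §3 Prop. 3: not even by Chern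
classes of coherent sheaves). This is the tree's barrier `Voisin2002_weilTorus_hodgeClassWithoutSubvarieties`
with its proved consequence `not_kaehlerSubvarietiesOrLineBundlesDetectClasses`, re-exported so that the
dependency of this crux analysis on it is explicit: the analytic category has counterexamples of
exactly the Weil type that is open algebraically, so any argument for the crux must use an input that
fails for non-algebraic tori (field of definition, absolute Hodge / `Aut(ℂ)`, reduction mod `p` — the
route's p-adic anchors qualify). [cite: Voisin2002KaehlerCounterexample, Thm. 1 and §3 Prop. 3]
[cite: Zucker1977] -/
theorem kaehler_analogue_fails
    (h : Literature.Barriers.HodgeConjecture.Voisin2002_weilTorus_hodgeClassWithoutSubvarieties) :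
    ¬ Literature.Barriers.HodgeConjecture.KaehlerSubvarietiesOrLineBundlesDetectClasses (Fin 4 → ℂ) :=
  Literature.Barriers.HodgeConjecture.not_kaehlerSubvarietiesOrLineBundlesDetectClasses h

/-! ## §7 Kill-transfer hub: every typed abelian-variety instance of HC in the tree is BELOW the crux -/

/-- Generic specialisation of the crux at a prescribed dimension `A.dim = m` and codimension `p`
(the rewriting step shared by all transfers below). [folklore] -/
theorem apply_of_dim_eq (h : HodgeAbelianVarieties) (A : AbelianVariety ℂ) {m : ℕ} (hA : A.dim = m)
    (p : ℕ) (c : singularCohomology ℂ ℂ (ComplexPoints A.X) (2 * p)) (hc : IsRationalClass c)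
    (hH : IsOfHodgeType m A.X (2 * p) p p c) : c ∈ algebraicClasses A.X p := by
  have h2 := (h A).2 p c
  rw [hA] at h2
  exact h2 hc hH

-- Crux ⇒ `HeckeOrbitCompactness.WeilClassesAlgebraic` (Weil classes on Weil-type `2n`-folds, `n ≥ 2`,
-- eigen-decomposition form) — LANDED (KillTransfer.lean, p73980); kept here as a comment because the route module
-- is not imported in v4 (see the import block):
--   theorem heckeOrbitCompactness_weilClassesAlgebraic_of (h : HodgeAbelianVarieties) :
--       Summit.HodgeConjecture.HodgeConjecture.Theses.HeckeOrbitCompactness.WeilClassesAlgebraic :=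
--     fun n _ _ _ A _ hA _ _ c hc hH _ ↦ apply_of_dim_eq h A hA n c hc hH

/-- Crux ⇒ `DegreeSpectroscopy.WeilClassesAlgebraic` (general quadratic `f² - a f + b = 0`,
eigenspace form). [cite: Weil1977HodgeRing] -/
theorem degreeSpectroscopy_weilClassesAlgebraic_of (h : HodgeAbelianVarieties) :
    Summit.HodgeConjecture.HodgeConjecture.Theses.DegreeSpectroscopy.WeilClassesAlgebraic :=
  fun A n _ _ _ hA _ _ _ _ c hc hH _ ↦ apply_of_dim_eq h A hA n c hc hH

/-- Crux ⇒ `HeckePrymWeil.HodgeWeilLadder` (Weil classes for `K = ℚ(√-p)`, `p ≡ 3 (4)`, `p ≥ 7`,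
in the dimensions `2n`, `n = (p-1)/2·(g-1)`). [cite: Weil1977HodgeRing] -/
theorem heckePrymWeil_hodgeWeilLadder_of (h : HodgeAbelianVarieties) :
    Summit.HodgeConjecture.HodgeConjecture.Theses.HeckePrymWeil.HodgeWeilLadder :=
  fun _ _ _ _ _ _ n _ A _ hA _ c hc hH _ ↦ apply_of_dim_eq h A hA n c hc hH

/-- Crux ⇒ `HeckePrymWeil.WeilSixfoldsSqrtMinus7` (Weil classes on sixfolds with `φ² = -7`).
[cite: Weil1977HodgeRing] -/
theorem heckePrymWeil_weilSixfoldsSqrtMinus7_of (h : HodgeAbelianVarieties) :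
    Summit.HodgeConjecture.HodgeConjecture.Theses.HeckePrymWeil.WeilSixfoldsSqrtMinus7 :=
  fun A _ hA _ c hc hH _ ↦ apply_of_dim_eq h A hA 3 c hc hH

/-- Crux ⇒ `HeckePrymWeil.WeilTwelvefoldsSqrtMinus7`. [cite: Weil1977HodgeRing] -/
theorem heckePrymWeil_weilTwelvefoldsSqrtMinus7_of (h : HodgeAbelianVarieties) :
    Summit.HodgeConjecture.HodgeConjecture.Theses.HeckePrymWeil.WeilTwelvefoldsSqrtMinus7 :=
  fun A _ hA _ c hc hH _ ↦ apply_of_dim_eq h A hA 6 c hc hH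

/-- Crux ⇒ `HeckePrymWeil.WeilTenfoldsSqrtMinus11`. [cite: Weil1977HodgeRing] -/
theorem heckePrymWeil_weilTenfoldsSqrtMinus11_of (h : HodgeAbelianVarieties) :
    Summit.HodgeConjecture.HodgeConjecture.Theses.HeckePrymWeil.WeilTenfoldsSqrtMinus11 :=
  fun A _ hA _ c hc hH _ ↦ apply_of_dim_eq h A hA 5 c hc hH

/-- Crux ⇒ `HeckePrymWeil.WeilDescending` (its conclusion is an instance of the crux; the descent
hypothesis is not needed). [cite: Weil1977HodgeRing] -/
theorem heckePrymWeil_weilDescending_of (h : HodgeAbelianVarieties) :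
    Summit.HodgeConjecture.HodgeConjecture.Theses.HeckePrymWeil.WeilDescending :=
  fun _ _ _ _ n _ _ A _ hA _ c hc hH _ ↦ apply_of_dim_eq h A hA n c hc hH

/-- Crux ⇒ `NodalThetaWeil.WeilSixfolds` (Weil classes on Weil-type sixfolds, every `d`).
[cite: Weil1977HodgeRing] -/
theorem nodalThetaWeil_weilSixfolds_of (h : HodgeAbelianVarieties) :
    Summit.HodgeConjecture.HodgeConjecture.Theses.NodalThetaWeil.WeilSixfolds :=
  fun _ _ A _ hA _ _ c hc hH _ ↦ apply_of_dim_eq h A hA 3 c hc hH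

/-- Crux ⇒ `NodalThetaWeil.NodeDualClassesAlgebraic` (Weil classes supported on a divisor are
algebraic — a WEAKENING of `WeilSixfolds`, a fortiori below the crux). [cite: Weil1977HodgeRing] -/
theorem nodalThetaWeil_nodeDualClassesAlgebraic_of (h : HodgeAbelianVarieties) :
    Summit.HodgeConjecture.HodgeConjecture.Theses.NodalThetaWeil.NodeDualClassesAlgebraic :=
  fun _ _ A _ hA _ _ c hc hH _ _ ↦ apply_of_dim_eq h A hA 3 c hc hH

/-- Crux ⇒ `SupersingularIsotypicLift.CMAbelianHodge` (HC for abelian varieties with a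
commutative reduced subalgebra of `End⁰` of rank `2 dim A`, i.e. of CM type). [cite: Deligne1982HodgeCycles] -/
theorem supersingularIsotypicLift_cmAbelianHodge_of (h : HodgeAbelianVarieties) :
    Summit.HodgeConjecture.HodgeConjecture.Theses.SupersingularIsotypicLift.CMAbelianHodge :=
  fun A _ _ ↦ h A

/-- **The crux is the summit modulo the complement items of three other routes.** With
`ConservativityLefschetz.AbelianComplement` (HC for abelian varieties ⇒ HC), the crux GIVES the
Hodge conjecture; conversely HC gives both. [folklore] -/
theorem hodgeConjecture_iff_and_abelianComplement :
    _root_.HodgeConjecture ↔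
      HodgeAbelianVarieties ∧
        Summit.HodgeConjecture.HodgeConjecture.Theses.ConservativityLefschetz.AbelianComplement :=
  ⟨fun hc ↦ ⟨fun A ↦ hc (AbelianVariety.isSmoothProjective_holds (A := A)), fun _ ↦ hc⟩,
    fun ⟨h, hcomp⟩ ↦ hcomp fun A _ ↦ h A⟩

-- Same with `HeckeOrbitCompactness.SummitOffWeilSector` (HC off the Weil sector, given Weil classes): crux ∧
-- that item ⇒ HC — LANDED (KillTransfer.lean, p73980); comment-only in v4:
--   theorem hodgeConjecture_of_heckeOrbitCompactness_summitOffWeilSector (h : HodgeAbelianVarieties)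
--       (hoff : Summit.HodgeConjecture.HodgeConjecture.Theses.HeckeOrbitCompactness.SummitOffWeilSector) :
--       _root_.HodgeConjecture :=
--     hoff (heckeOrbitCompactness_weilClassesAlgebraic_of h)

/-- Same with `HeckePrymWeil.SummitOffWeilSector`. [folklore] -/
theorem hodgeConjecture_of_heckePrymWeil_summitOffWeilSector (h : HodgeAbelianVarieties)
    (hoff : Summit.HodgeConjecture.HodgeConjecture.Theses.HeckePrymWeil.SummitOffWeilSector) :
    _root_.HodgeConjecture :=
  hoff fun _ _ _ _ n _ A _ hA _ c hc hH _ ↦ apply_of_dim_eq h A hA n c hc hH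

/-! ## §8 Natural strengthenings refuted in print, over the tree's vocabulary -/

/-- The DIVISOR-GENERATED strengthening of the crux: every rational `(p,p)`-class on a complex
abelian variety is a `ℂ`-combination of `p`-fold cup products of rational `(1,1)`-classes
(`Bᵖ = Dᵖ` in van Geemen's notation) — the statement behind every classical positive case
(Mattuck: general abelian varieties; Tate–Imai–Murasaki: products of elliptic curves, e.g. the
route's anchors `E^{2n}`; Tankeev–Ribet: simple of prime dimension). [cite: vanGeemen1994HodgeAV, §2.4–2.5] -/
def HodgeRingDivisorGeneratedOnAbelianVarieties : Prop :=
  ∀ (A : AbelianVariety ℂ) (p : ℕ) (c : singularCohomology ℂ ℂ (ComplexPoints A.X) (2 * p)),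
    IsRationalClass c → IsOfHodgeType A.dim A.X (2 * p) p p c →
      c ∈ Literature.Barriers.HodgeConjecture.divisorClassesSpan A.X A.dim p

/-- **`Bᵖ = Dᵖ` fails on abelian varieties (Weil 1977; van Geemen LNM 1594 Thm. 4.11), from the
tree's barrier fact `Weil1977_exceptionalHodgeClasses`:** already in dimension `4`, `p = 2`, a
general abelian fourfold of Weil type carries a rational `(2,2)`-class outside `D²`. Consequence
for THIS route: at a supersingular anchor `E^{2n}/𝔽_{p²}` every class IS a polynomial in divisor
classes, but the divisors realising the specialised Weil class cannot all lift to the Weil-type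
generic fibre (there `B¹ = ℚ`), so "specialise, write in divisors, lift the divisors" is not a
mechanism — the seeds must be genuinely non-divisorial objects (as the card says: sheaves).
[cite: vanGeemen1994HodgeAV, Thm. 4.11] [cite: Weil1977HodgeRing] -/
theorem not_hodgeRingDivisorGeneratedOnAbelianVarieties
    (hW : Literature.Barriers.HodgeConjecture.Weil1977_exceptionalHodgeClasses) :
    ¬ HodgeRingDivisorGeneratedOnAbelianVarieties := by
  intro hD
  obtain ⟨A, hdim, -, c, hc, hH, hnot⟩ := hW 2 le_rfl
  refine hnot ?_
  have h := hD A 2 c hc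
  rw [hdim] at h
  exact h hH

/-- The same failure on a SIMPLE abelian fourfold (Mumford 1968 / Pohlmann; van Geemen Thm. 4.5),
from the barrier fact `Mumford1968_simpleFourfold_exceptionalHodgeClasses`: simplicity / prime-
dimension reductions à la Tankeev–Ribet do not rescue `Bᵖ = Dᵖ` in dimension `4`.
[cite: vanGeemen1994HodgeAV, Thm. 4.5 and Thm. 4.12] -/
theorem not_hodgeRingDivisorGenerated_simple
    (hM : Literature.Barriers.HodgeConjecture.Mumford1968_simpleFourfold_exceptionalHodgeClasses) :
    ¬ ∀ (A : AbelianVariety ℂ), A.IsSimple → ∀ (p : ℕ)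
        (c : singularCohomology ℂ ℂ (ComplexPoints A.X) (2 * p)),
        IsRationalClass c → IsOfHodgeType A.dim A.X (2 * p) p p c →
          c ∈ Literature.Barriers.HodgeConjecture.divisorClassesSpan A.X A.dim p := by
  intro hD
  obtain ⟨A, hs, hdim, -, c, hc, hH, hnot⟩ := hM
  refine hnot ?_
  have h := hD A hs 2 c hc
  rw [hdim] at h
  exact h hH

/-- Conversely the crux CONTAINS the divisor-generated cases for free only through Lefschetz
`(1,1)` and cup products: granting the tree facts `lefschetzOneOne_rational` and
`algebraicClasses_cup` (cup product of algebraic classes is algebraic), every class of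
`divisorClassesSpan A.X A.dim p` is algebraic — so `HodgeRingDivisorGeneratedOnAbelianVarieties`
would IMPLY the cycle part of the crux; its failure (above) is why the crux is open exactly at the
exceptional classes. Stated as the implication between the two `Prop`s under the named facts.
[cite: vanGeemen1994HodgeAV, §2.4] -/
theorem cyclePart_of_divisorGenerated
    (hcup : ∀ (A : AbelianVariety ℂ) (p : ℕ),
      Literature.Barriers.HodgeConjecture.divisorClassesSpan A.X A.dim p ≤ algebraicClasses A.X p)
    (hD : HodgeRingDivisorGeneratedOnAbelianVarieties) (A : AbelianVariety ℂ) (p : ℕ)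
    (c : singularCohomology ℂ ℂ (ComplexPoints A.X) (2 * p)) (hc : IsRationalClass c)
    (hH : IsOfHodgeType A.dim A.X (2 * p) p p c) : c ∈ algebraicClasses A.X p :=
  hcup A p (hD A p c hc hH)

/-! ## §9 Positive by-product for the lead (not a refutation; evidence only)

The typed first lemma `IdeatorTwoSketch.ker_map_eq_of_ker_eq` of the 3/3-passing card
`e-step-secant-induction` ("Markman's criterion `ker ev_F = ker (⌟ch F)` is stable under `⊠`") was
left `sorry` by the ideator. It is TRUE, in greater generality than typed (the kernel equality needs no
surjectivity): over a field `ker (f ⊗ g) = A₁ ⊗ ker g + ker f ⊗ A₂` depends only on the two kernels.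
Sorry-free proof below (Mathlib: right exactness `TensorProduct.map_ker` on `A ↠ range`, flat
injectivity `TensorProduct.map_injective_of_flat_flat` on `range ↪ B`). Attached to the crux item as
evidence `EStep.lean`; a lead picking that line may cite or inline it. -/

section EStep

open scoped TensorProduct
open LinearMap

variable {𝕜 : Type*} [Field 𝕜] {A₁ A₂ B₁ B₂ C₁ C₂ : Type*} [AddCommGroup A₁] [AddCommGroup A₂]
  [AddCommGroup B₁] [AddCommGroup B₂] [AddCommGroup C₁] [AddCommGroup C₂] [Module 𝕜 A₁]
  [Module 𝕜 A₂] [Module 𝕜 B₁] [Module 𝕜 B₂] [Module 𝕜 C₁] [Module 𝕜 C₂]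

/-- Over a field, the kernel of `f ⊗ g` is `A₁ ⊗ ker g + ker f ⊗ A₂` (right exactness of `⊗` on
the surjections `A ↠ range`, plus injectivity of `range f ⊗ range g ↪ B₁ ⊗ B₂` by flatness).
[folklore] -/
theorem ker_tensorMap_eq (f : A₁ →ₗ[𝕜] B₁) (g : A₂ →ₗ[𝕜] B₂) :
    ker (TensorProduct.map f g) =
      range (lTensor A₁ (ker g).subtype) ⊔ range (rTensor A₂ (ker f).subtype) := by
  have hfac : TensorProduct.map f g =
      TensorProduct.map (range f).subtype (range g).subtype ∘ₗ
        TensorProduct.map f.rangeRestrict g.rangeRestrict := by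
    rw [← TensorProduct.map_comp]; rfl
  have hinj : Function.Injective (TensorProduct.map (range f).subtype (range g).subtype) :=
    TensorProduct.map_injective_of_flat_flat _ _ (range f).subtype_injective
      (range g).subtype_injective
  rw [hfac, LinearMap.ker_comp_of_ker_eq_bot _ (LinearMap.ker_eq_bot.2 hinj)]
  have h1 : Function.Exact (ker f).subtype f.rangeRestrict :=
    LinearMap.exact_iff.2 (by rw [ker_rangeRestrict, Submodule.range_subtype])
  have h2 : Function.Exact (ker g).subtype g.rangeRestrict :=
    LinearMap.exact_iff.2 (by rw [ker_rangeRestrict, Submodule.range_subtype])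
  exact TensorProduct.map_ker h1 (surjective_rangeRestrict f) h2 (surjective_rangeRestrict g)

/-- Monotonicity: bigger kernels give a bigger kernel of the tensor map. [folklore] -/
theorem ker_tensorMap_mono (f : A₁ →ₗ[𝕜] B₁) (f' : A₁ →ₗ[𝕜] C₁) (g : A₂ →ₗ[𝕜] B₂)
    (g' : A₂ →ₗ[𝕜] C₂) (h₁ : ker f ≤ ker f') (h₂ : ker g ≤ ker g') :
    ker (TensorProduct.map f g) ≤ ker (TensorProduct.map f' g') := by
  rw [ker_tensorMap_eq]
  refine sup_le ?_ ?_
  · rintro _ ⟨t, rfl⟩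
    rw [mem_ker, ← LinearMap.comp_apply]
    suffices h : TensorProduct.map f' g' ∘ₗ lTensor A₁ (ker g).subtype = 0 by
      rw [h, LinearMap.zero_apply]
    refine TensorProduct.ext' fun a k ↦ ?_
    have hk : g' k = 0 := mem_ker.1 (h₂ k.2)
    simp [hk]
  · rintro _ ⟨t, rfl⟩
    rw [mem_ker, ← LinearMap.comp_apply]
    suffices h : TensorProduct.map f' g' ∘ₗ rTensor A₂ (ker f).subtype = 0 by
      rw [h, LinearMap.zero_apply]
    refine TensorProduct.ext' fun k a ↦ ?_
    have hk : f' k = 0 := mem_ker.1 (h₁ k.2)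
    simp [hk]

/-- **The card's first lemma, proved in full generality**: if `ker ev₁ = ker c₁` and
`ker ev₂ = ker c₂` then `ker (ev₁ ⊗ ev₂) = ker (c₁ ⊗ c₂)`; surjectivity of `ev₁ ⊗ ev₂` follows from
that of the factors. (Same binder shape as `IdeatorTwoSketch.ker_map_eq_of_ker_eq`.) [folklore] -/
theorem ker_map_eq_of_ker_eq (ev₁ : A₁ →ₗ[𝕜] B₁) (c₁ : A₁ →ₗ[𝕜] C₁) (ev₂ : A₂ →ₗ[𝕜] B₂)
    (c₂ : A₂ →ₗ[𝕜] C₂) (h₁ : LinearMap.ker ev₁ = LinearMap.ker c₁)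
    (h₂ : LinearMap.ker ev₂ = LinearMap.ker c₂)
    (s₁ : Function.Surjective ev₁) (s₂ : Function.Surjective ev₂) :
    LinearMap.ker (TensorProduct.map ev₁ ev₂) = LinearMap.ker (TensorProduct.map c₁ c₂) ∧
      Function.Surjective (TensorProduct.map ev₁ ev₂) :=
  ⟨le_antisymm (ker_tensorMap_mono _ _ _ _ h₁.le h₂.le) (ker_tensorMap_mono _ _ _ _ h₁.ge h₂.ge),
    TensorProduct.map_surjective s₁ s₂⟩

end EStep

/-! ## §10 Pre-pick note on the candidate lines (skeletons of 2026-08-16T01:14Z): the e-step line's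
four stubs are all BELOW the crux

`Lines/e-step-secant-induction.lean` registers `stub_splitSixfolds`, `stub_eTower`, `stub_descend`,
`stub_weilSectorSuffices`. Their statements (copied VERBATIM below — the Lines file is not an importable
module) are each implied by the crux, hence by HC: no drefute/cdisprove attack can kill any of them unless
the Hodge conjecture fails; that line can only fail by being UNPROVABLE (stub 2 `ETower` = Weil classes on
split Weil-type `2n`-folds, `n ≥ 4`, open in print), never by a false stub. The other two skeletons
(`subtorus-gallery-bloch-seeds`, `symmetry-ladder-isotypic-obstructions`) quantify over DATA interfaces
(`ChernCharacterBetti`, gallery/seed packages) and are the ones where junk-(un)satisfiability must be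
tested once a line is picked (next arm's Targets). -/

namespace EStepLine

/-- Verbatim copy of `EStepSecantInduction.WeilAlgebraicFor`. [cite: Weil1977HodgeRing] -/
def WeilAlgebraicFor (n d : ℕ) (A : AbelianVariety ℂ) (φ : A ⟶ A) : Prop :=
  ∀ c ∈ weilClassesOf A φ n d, IsRationalClass c → IsOfHodgeType (2 * n) A.X (2 * n) n n c →
    c ∈ algebraicClasses A.X n

/-- Verbatim copy of `EStepSecantInduction.WeilAlgebraicAll`. [cite: Weil1977HodgeRing] -/
def WeilAlgebraicAll (n d : ℕ) : Prop :=
  ∀ (A : AbelianVariety ℂ) (φ : A ⟶ A), A.dim = 2 * n → φ ≫ φ = -(d • 𝟙 A) → WeilAlgebraicFor n d A φ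

/-- Verbatim copy of `EStepSecantInduction.IsSplitWeilTriple`. [cite: vanGeemen1994HodgeAV, 5.2–5.4] -/
def IsSplitWeilTriple (n d : ℕ) (A : AbelianVariety ℂ) (φ : A ⟶ A) (h : complexBetti A.X 2) : Prop :=
  A.dim = 2 * n ∧ φ ≫ φ = -(d • 𝟙 A) ∧ IsPolarizationClass (2 * n) A.X h ∧
    complexBetti.map φ.hom.hom.hom 2 h = (d : ℂ) • h ∧ IsHyperbolicWeilType A φ n h

/-- Verbatim copy of `EStepSecantInduction.WeilAlgebraicSplit`. [cite: Markman2025SurveySecant, §11.5] -/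
def WeilAlgebraicSplit (n d : ℕ) : Prop :=
  ∀ (A : AbelianVariety ℂ) (φ : A ⟶ A) (h : complexBetti A.X 2),
    IsSplitWeilTriple n d A φ h → WeilAlgebraicFor n d A φ

/-- Verbatim copies of the four stub statements `SplitSixfolds`, `ETower`, `Descend`,
`WeilSectorSuffices` of the e-step skeleton. [cite: Markman2025SurveySecant, §11.5 and §12] -/
def SplitSixfolds : Prop := ∀ d : ℕ, 0 < d → WeilAlgebraicSplit 3 d
/-- See `SplitSixfolds`. [cite: Markman2025SurveySecant, §12] -/
def ETower : Prop := ∀ n d : ℕ, 4 ≤ n → 0 < d → WeilAlgebraicSplit n d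
/-- See `SplitSixfolds`. [cite: Markman2025SurveySecant, §11.5] -/
def Descend : Prop := ∀ n d : ℕ, 2 ≤ n → 0 < d → WeilAlgebraicSplit (n + 1) d → WeilAlgebraicAll n d
/-- See `SplitSixfolds`. [folklore] -/
def WeilSectorSuffices : Prop :=
  Summit.HodgeConjecture.HodgeConjecture.Theses.TropicalCuspLift.WeilClassesAlgebraic → HodgeAbelianVarieties

/-- Crux ⇒ Weil classes on ALL Weil-type pairs of dimension `2n` (every `n`, `d`). [folklore] -/
theorem weilAlgebraicAll_of_crux (h : HodgeAbelianVarieties) (n d : ℕ) : WeilAlgebraicAll n d :=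
  fun A _ hA _ c _ hc hH ↦ apply_of_dim_eq h A hA n c hc hH

/-- Crux ⇒ the split sector (a fortiori). [folklore] -/
theorem weilAlgebraicSplit_of_crux (h : HodgeAbelianVarieties) (n d : ℕ) : WeilAlgebraicSplit n d :=
  fun A _ _ ht c _ hc hH ↦ apply_of_dim_eq h A ht.1 n c hc hH

/-- **All four e-step stubs are consequences of the crux** (hence irrefutable unless HC fails).
[folklore] -/
theorem all_stubs_of_crux (h : HodgeAbelianVarieties) :
    SplitSixfolds ∧ ETower ∧ Descend ∧ WeilSectorSuffices :=
  ⟨fun d _ ↦ weilAlgebraicSplit_of_crux h 3 d, fun n d _ _ ↦ weilAlgebraicSplit_of_crux h n d,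
    fun n d _ _ _ ↦ weilAlgebraicAll_of_crux h n d, fun _ ↦ h⟩

end EStepLine

/-! ## §11 (cycle 3) No-go for `{0,1}`-semiregular seeds — the symmetry-ladder line's Stub 1 is
false for `n ≥ 3`, Stub 2 vacuous

The registered skeleton `Lines/symmetry-ladder-isotypic-obstructions.lean` certifies Weil classes by
`{0,1}`-SEMIREGULAR finite locally free seeds `E` on fibres of smooth projective families of abelian
varieties, whose `ch₁`, `ch₂` are restrictions of GLOBAL classes of type `(1,1)`, `(2,2)` on every fibre
(`SeedAt`). The theorem below shows that such seeds never carry a non-Lefschetz class in degree `2n ≥ 6`.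

**Theorem (no-go for `{0,1}`-semiregular seeds; this file, cycle 3).** Let `A` be a complex abelian
variety of dimension `g`, `θ ∈ H²(A(ℂ); ℚ)` a polarisation class (rational, type `(1,1)`, `θ^g ≠ 0`),
and `E` a finite locally free sheaf — or any perfect complex — on `A` such that
`(σ₀, σ₁) : Ext²(E,E) → H²(𝒪_A) ⊕ H³(Ω¹_A)` is injective and `ch₁(E) ∈ ℂθ`, `ch₂(E) ∈ ℂθ²`. Then
`ch_q(E) ∈ ℂθ^q` for every `q ≥ 0`.

*Proof.* Write `P = H^{1,0}`, `Q = H^{0,1} ≅ P^∨` (duality through `θ`), so `H^{p,q}(A) = ∧ᵖP ⊗ ∧^qQ`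
and `H¹(A, Θ_A) = Q ⊗ P^∨ = Hom(P, Q)`; the contraction `⟨ξ, ·⟩ : H^{p,q} → H^{p-1,q+1}` replaces one
`P`-vector `v` by `ξ(v)`. (1) For `ξ ∈ H¹(Θ_A)` the class `ob_ξ := ⟨ξ, -At(E)⟩ ∈ Ext²(E,E)` vanishes
iff `E` extends over the first-order deformation `A_ξ` (Buchweitz–Flenner 2003, Prop. 4.4), and
`σ_k(ob_ξ) = ⟨ξ, ch_{k+1}(E)⟩ ∈ H^{k+2}(Ω^k)` for EACH `k ≥ 0` (BF Cor. 4.3: the triangle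
`H^{r-1}(Θ) → Ext^r(F,F) → H^{k+r}(Ω^k)` commutes, `r = 2`). (2) `⟨ξ, θ⟩ = 0` iff `ξ ∈ Sym²Q`
(symmetric for the duality), and then `⟨ξ, θ²⟩ = 2θ⟨ξ, θ⟩ = 0` (`⟨ξ, ·⟩` is a derivation). Hence for
`ξ ∈ Sym²Q`: `σ₀(ob_ξ) = a⟨ξ, θ⟩ = 0` and `σ₁(ob_ξ) = b⟨ξ, θ²⟩ = 0`, so `ob_ξ = 0` by injectivity, so
`⟨ξ, ch_q(E)⟩ = σ_{q-1}(ob_ξ) = 0` for ALL `q ≥ 1`. (3) RIGIDITY LEMMA: for `1 ≤ q ≤ g-1`,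
`R_q := {y ∈ ∧^qP ⊗ ∧^qQ : ⟨ξ, y⟩ = 0 ∀ ξ ∈ Sym²Q} = ℂ·θ^q`. Indeed `R_q` is `GL(P)`-stable (the family
`{⟨ξ,·⟩ : ξ ∈ Sym²Q}` is equivariant), `∧^qP ⊗ ∧^qP^∨ = ⊕_{k=0}^{min(q,g-q)} V_k` multiplicity-free
(`V_k` of highest weight `(1^k, 0, …, 0, (-1)^k)`), `θ^q` spans the invariants `V_0`, and for `k ≥ 1` the
highest weight vector `y_k = Σ_M e_{[k]} ∧ e_M ⊗ e^M ∧ e^{[g-k+1,g]}` of `V_k` has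
`⟨(e¹)², y_k⟩ = 2 Σ_M e_{[2,k]} ∧ e_M ⊗ e¹ ∧ e^M ∧ e^{[g-k+1,g]} ≠ 0`, so `V_k ⊄ R_q`. (Machine
certificate of `dim (R_q ∩ weight 0) = 1`, equivalent to the lemma: exact integer arithmetic, rank mod two
primes, `θ^q ∈ ker` exactly — `kit/rigidity_lemma.py`, run locally for all `2 ≤ g ≤ 9` (evidence
`rigidity_lemma_results.json`), queued as `kit` job j010030 for `g ≤ 12`.) (4) Top and bottom degrees are trivial (`H^{g,g} = ℂθ^g`,
`ch₀ = rank`). ∎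

**Corollary.** If `B¹(A) = ℚθ` and `B²(A) = ℚθ²` — e.g. `A` a very general member of the Weil-type
family of dimension `2n ≥ 6` for `K = ℚ(√-d)` (Mumford–Tate derived group `SU(V,H) ≅ SU(n,n)`; the
`SU`-invariants of `∧^{2p}(W ⊕ W^∨)` are `ℂθ^p` for `p ≠ n` and `ℂθⁿ ⊕ ∧^{2n}W ⊕ ∧^{2n}W^∨` for
`p = n`: Weil 1977, van Geemen LNM 1594 Thm. 6.12) — then EVERY `{0,1}`-semiregular vector bundle on
`A` has `ch(E) ∈ ℚ[θ]`; none has a non-zero Weil component in `ch_n`. (Chern classes of holomorphic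
bundles are rational Hodge classes, Voisin I Prop. 11.27.)

**Sharper form (which component does the work).** On a very general Weil-type `2n`-fold (`n ≥ 2`) let
`E` be ANY coherent sheaf / perfect complex whose `ch_n` has a non-zero RATIONAL Weil component (so both
eigen-components `∧^{2n}V_σ`, `∧^{2n}V_σ̄` occur). For `ξ` in the non-`K`-linear polarised directions
`Sym²Q_σ ⊕ Sym²Q_σ̄` (dimension `n(n+1)`), `⟨ξ, ch_n(E)⟩ ≠ 0` unless `ξ = 0` (the computation
`⟨(q̄)², ∧ⁿP_σ ⊗ ∧ⁿQ_σ⟩ ≠ 0`), hence `ob_ξ ≠ 0`: the obstruction map is INJECTIVE on these directions, so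
`dim Ext²(E,E) ≥ n(n+1)`; and `σ_q(ob_ξ) = ⟨ξ, ch_{q+1}(E)⟩ = 0` for every `q ≠ n - 1` (`B^{q+1} = ℚθ^{q+1}`
there), while `σ_{n-1}(ob_ξ) = ⟨ξ, ch_n(E)⟩ ≠ 0`. Consequently `ker (⊕_{q ∈ I} σ_q) ⊇ ob(Sym²Q_σ ⊕ Sym²Q_σ̄)`
has dimension `≥ n(n+1)` for EVERY index set `I ∌ n - 1`: **`I`-semiregular Weil seeds exist only if
`n - 1 ∈ I`** (`n = 2`: `σ₁ ∈ {σ₀, σ₁}`, consistent with Markman's fourfolds; `n ≥ 3`: `{0,1}` is dead, and so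
is every package omitting `σ_{n-1}`).

**Application 1 (Stub 1 of the symmetry-ladder line is false; Stub 2 vacuous).** See
`stub_weilSectorSeeds_false` below: for every `T : ChernCharacterBetti` the fields force
`T.ch_q = λ^q ch_q^top` on smooth projective varieties (`λ = T.ch₁(𝒪_{ℙ¹}(1))/h ∈ ℚ`: additivity on
`0 → 𝒪(-1) → 𝒪² → 𝒪(1) → 0`, functoriality along Veronese maps, linear sections and `(φ₁, φ₂) : X →
ℙᴺ × ℙᴹ` for `L = φ₁^*𝒪(1) ⊗ φ₂^*𝒪(-1)`, the exponential field and the splitting principle on the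
projective flag bundle — Leray–Hirsch injectivity); take `n = 3`, `d = 1`, `(A, φ)` very general of
Weil type with a non-zero rational `(3,3)` Weil class `c` (the whole Weil plane is Hodge there). If
`Certified[T, A, 3, c]` held with family `f : 𝒳 → S`, `A ≅ 𝒳_{s₁}`, global `W`, seeds `(E_j, G_j, z_j)`:
`S(ℂ)` is connected (`S` irreducible) and `𝒳(ℂ) → S(ℂ)` is a proper submersion, so restrictions of a
global class to two fibres are parallel transports of each other and a global class vanishing on one
fibre vanishes on all; `G₁^{(j)}|_{z_j} = T.ch₁(E_j)` is rational, so `G₁^{(j)}` agrees fibrewise with a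
RATIONAL global class, whose restriction at `s₁` is a rational `(1,1)`-class on the very general `A`,
i.e. `∈ ℚθ = ℚ·Θ|_{s₁}/m` (`Θ` the hyperplane class of `𝒳 ⊂ ℙᴺ × S`); hence `G₁^{(j)} = a_j Θ`
fibrewise, likewise `G₂^{(j)} = b_j Θ²` (`B²(A) = ℚθ²` as `n ≥ 3`); so at `z_j` the bundle `E_j` on the
polarised abelian variety `(𝒳_{z_j}, Θ|_{z_j})` satisfies the hypotheses of the theorem (`λ ≠ 0`; if
`λ = 0` then `T.ch_n ≡ 0` and the seeds contribute nothing), whence `T.ch_n(E_j) = c_j Θⁿ|_{z_j}`, whence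
`G_j = c_j Θⁿ` fibrewise, `(u^*G_j)|_{s₁} = c_j (u_{s₁}^*θ')ⁿ ∈ ℂθⁿ` (`u_{s₁}^*` of a rational
`(1,1)`-class is one, and `B¹(A) = ℚθ`) and `DivPow|_{s₁} ⊆ ℂθⁿ`; so `c = W|_{s₁} ∈ ℂθⁿ ∩ (E₊ ⊕ E₋) = 0`,
contradiction. For `n = 2` nothing is claimed (`ch₂` is itself the target degree — Markman's theorem).

**Application 2 (the route's seed package).** `{0,1}`-semiregularity of `E₁` on the special fibre of a
smooth projective `𝒳/W(k)` with torsion-free Hodge cohomology passes to every lift `E/𝒳`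
(`0 → Ext²_W(E,E) ⊗ k → Ext²(E₁,E₁)` for the perfect complex `RHom(E,E)`; the targets `H²(𝒪)`,
`H³(Ω¹)` are free and commute with base change; a kernel element of `σ_W` not divisible by `p` would
reduce to a kernel element mod `p`), hence to the complex generic fibre. So with the ZERO higher-`σ`
package (`IsPadicSemiregular 0 ↔ IsZeroOneSemiregular`, `Cruxes/SemiregularSeedsOnAnchors/TypedCrux.lean`)
the composite `P1 ∘ P2` yields on a lifted Weil-type `2n`-fold with `B¹ = ℚθ`, `B² = ℚθ²` (`n ≥ 3`) a
`{0,1}`-semiregular bundle with `ch ∈ ℚ[θ]` — never a Weil class: the higher package must be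
non-trivial in form degree `n - 1` (the `Ω^a` definition request is load-bearing for sixfolds and up).

References: [cite: BuchweitzFlenner2003, Cor. 4.3 and Prop. 4.4] [cite: vanGeemen1994HodgeAV, Thm. 6.12]
[cite: VoisinHodgeI2002, Prop. 11.27 and Thm. 11.23] [cite: Weil1977HodgeRing]. -/

namespace SymmetryLadderLine

/-! ### Verbatim copies of the skeleton's notations and of the two stub statements concerned
(`Lines/symmetry-ladder-isotypic-obstructions.lean` is not an importable module). -/

local notation3 (prettyPrint := false) "Res[" f ", " s ", " k ", " A "]" =>
  complexBetti.map (Motives.fiberι f s) k A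

local notation3 (prettyPrint := false) "AVFamily[" 𝒳 ", " S ", " f ", " n "]" =>
  (Motives.IsSmoothProjectiveFamily f n ∧
    (∃ (N : ℕ) (ι : 𝒳 ⟶ Motives.projectiveSpace N ℂ ⊗ S),
      IsClosedImmersion ι.left ∧ ι ≫ SemiCartesianMonoidalCategory.snd (Motives.projectiveSpace N ℂ) S = f) ∧
    IsQuasiProjectiveOver S ∧ Smooth (S).hom ∧ IrreducibleSpace (S).left ∧
    (∀ s : Motives.ComplexPoints S, ∃ B : AbelianVariety ℂ, B.dim = n ∧ Nonempty (B.X ≅ Motives.fiberOver f s)))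

local notation3 (prettyPrint := false) "FlatHodge[" f ", " n ", " p ", " A "]" =>
  (∀ s, IsRationalClass (Res[f, s, 2 * p, A]) ∧
    IsOfHodgeType n (Motives.fiberOver f s) (2 * p) p p (Res[f, s, 2 * p, A]))

local notation3 (prettyPrint := false) "DivPow[" 𝒳 ", " f ", " n ", " p "]" =>
  {x : complexBetti 𝒳 (2 * p) | ∃ h : complexBetti 𝒳 (2 * 1),
    (∀ s, IsRationalClass (Res[f, s, 2 * 1, h]) ∧
      IsOfHodgeType n (Motives.fiberOver f s) (2 * 1) 1 1 (Res[f, s, 2 * 1, h])) ∧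
    x = cupPowTwo h p}

set_option linter.unusedVariables false in  -- `S` is a display-only parameter (verbatim copy)
local notation3 (prettyPrint := false) "SeedAt[" T ", " 𝒳 ", " S ", " f ", " n ", " p ", " G ", " z "]" =>
  (∃ (E : (Motives.fiberOver f z).left.Modules) (hE : Motives.IsFiniteLocallyFree E),
    IsZeroOneSemiregular hE ∧
    (∃ G₁ : complexBetti 𝒳 (2 * 1),
      (∀ s, IsOfHodgeType n (Motives.fiberOver f s) (2 * 1) 1 1 (Res[f, s, 2 * 1, G₁])) ∧
      (T : ChernCharacterBetti).ch (Motives.fiberOver f z) E 1 = Res[f, z, 2 * 1, G₁]) ∧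
    (∃ G₂ : complexBetti 𝒳 (2 * 2),
      (∀ s, IsOfHodgeType n (Motives.fiberOver f s) (2 * 2) 2 2 (Res[f, s, 2 * 2, G₂])) ∧
      (T : ChernCharacterBetti).ch (Motives.fiberOver f z) E 2 = Res[f, z, 2 * 2, G₂]) ∧
    (T : ChernCharacterBetti).ch (Motives.fiberOver f z) E p = Res[f, z, 2 * p, G])

local notation3 (prettyPrint := false) "Certified[" T ", " B ", " p ", " w "]" =>
  (∃ (𝒳 S : Motives.SchemeOver ℂ) (f : 𝒳 ⟶ S) (s₁ : Motives.ComplexPoints S)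
      (e : (B : AbelianVariety ℂ).X ≅ Motives.fiberOver f s₁) (W : complexBetti 𝒳 (2 * p)),
    AVFamily[𝒳, S, f, (B : AbelianVariety ℂ).dim] ∧ FlatHodge[f, (B : AbelianVariety ℂ).dim, p, W] ∧
    complexBetti.map e.hom (2 * p) (Res[f, s₁, 2 * p, W]) = w ∧
    ∃ (r : ℕ) (z : Fin r → Motives.ComplexPoints S) (G : Fin r → complexBetti 𝒳 (2 * p)),
      (∀ j, SeedAt[T, 𝒳, S, f, (B : AbelianVariety ℂ).dim, p, G j, z j]) ∧
      W ∈ Submodule.span ℂ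
        ({x : complexBetti 𝒳 (2 * p) | ∃ (j : Fin r) (u : 𝒳 ⟶ 𝒳), u ≫ f = f ∧
            x = complexBetti.map u (2 * p) (G j)} ∪ DivPow[𝒳, f, (B : AbelianVariety ℂ).dim, p]))

local notation3 (prettyPrint := false) "WeilSeeds[" T "]" =>
  (∀ (n d : ℕ), 2 ≤ n → 0 < d → ∀ (A : AbelianVariety ℂ) (φ : A ⟶ A), A.dim = 2 * n →
    φ ≫ φ = -(d • 𝟙 A) → ∀ c ∈ weilClassesOf A φ n d, IsRationalClass c →
      IsOfHodgeType (2 * n) A.X (2 * n) n n c → Certified[T, A, n, c])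

local notation3 (prettyPrint := false) "Generated[" T ", " A ", " p ", " c "]" =>
  (c ∈ Submodule.span ℂ {x : complexBetti (A : AbelianVariety ℂ).X (2 * p) |
    ∃ (B : AbelianVariety ℂ) (φ : A ⟶ B) (w : complexBetti B.X (2 * p)),
      Certified[T, B, p, w] ∧ x = complexBetti.map φ.hom.hom.hom (2 * p) w})

/-- Verbatim copy of the skeleton's `Goal.stub_weilSectorSeeds` (Stub 1, the line's first target).
[cite: Markman2025SurveySecant, §11.5 and §12] -/
def stub_weilSectorSeeds : Prop := ∃ T : ChernCharacterBetti, WeilSeeds[T]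

/-- Verbatim copy of the skeleton's `Goal.stub_seededGeneration` (Stub 2, ranked hardest).
[cite: Markman2025SurveySecant, Thm. 1.4] -/
def stub_seededGeneration : Prop := ∀ T : ChernCharacterBetti, WeilSeeds[T] →
    ∀ (A : AbelianVariety ℂ) (p : ℕ), 2 ≤ p → 2 * p ≤ A.dim →
      ∀ c : complexBetti A.X (2 * p), IsRationalClass c → IsOfHodgeType A.dim A.X (2 * p) p p c →
        Generated[T, A, p, c]

/-! ### The no-go theorem and its consequences, typed over the tree's real carriers -/

/-- **The no-go theorem for `{0,1}`-semiregular seeds, as a `Prop` on real carriers** (the CONCLUSION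
of the theorem proved on paper in the section docstring, in the generality the line consumes): on a
complex abelian variety `A` with a polarisation class `θ` (`IsPolarizationClass`: rational, supported on
a divisor, hard Lefschetz), every finite locally free `E` with `(σ₀, σ₁)` injective on `Ext²(E,E)`
(`IsZeroOneSemiregular`, the tree's REAL predicate) whose `T.ch₁`, `T.ch₂` are multiples of `θ`, `θ²`
has ALL `T.ch_q` multiples of `θ^q`, for every Chern character theory `T`. TRUE (section docstring:
BF Prop. 4.4 + Cor. 4.3 + the rigidity lemma + `T.ch = λ^q ch^top`); NOT provable in the tree (no
Hodge decomposition of `H*(A(ℂ))`, no Kodaira–Spencer classes, no BF calculus on real carriers).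
[cite: BuchweitzFlenner2003, Cor. 4.3 and Prop. 4.4] -/
def ZeroOneSemiregularChernRigidity : Prop :=
  ∀ (T : ChernCharacterBetti) (A : AbelianVariety ℂ) (θ : complexBetti A.X 2),
    IsPolarizationClass A.dim A.X θ →
    ∀ (E : A.X.left.Modules) (hE : Motives.IsFiniteLocallyFree E), IsZeroOneSemiregular hE →
      (∃ a : ℂ, T.ch A.X E 1 = a • θ) → (∃ b : ℂ, T.ch A.X E 2 = b • cupPowTwo θ 2) →
        ∀ q : ℕ, ∃ c : ℂ, T.ch A.X E q = c • cupPowTwo θ q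

/-- **Corollary, typed**: on an abelian variety all of whose rational `(1,1)`- and `(2,2)`-classes are
multiples of `θ`, `θ²` (e.g. a very general Weil-type `2n`-fold, `n ≥ 3`), the Chern character of EVERY
`{0,1}`-semiregular finite locally free sheaf is a polynomial in `θ` — granted the rigidity theorem and
the tree's rationality field `isRationalClass_ch` plus "Chern classes are of Hodge type `(i,i)`"
(Voisin I Prop. 11.27, here the hypothesis `hHdg`). Sorry-free bookkeeping. [cite: VoisinHodgeI2002, Prop. 11.27] -/
theorem chern_polynomial_in_theta_of_rigidity (hrig : ZeroOneSemiregularChernRigidity)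
    (T : ChernCharacterBetti) (A : AbelianVariety ℂ) (θ : complexBetti A.X 2)
    (hθ : IsPolarizationClass A.dim A.X θ)
    (hHdg : ∀ (E : A.X.left.Modules), Motives.IsFiniteLocallyFree E →
      ∀ i, IsOfHodgeType A.dim A.X (2 * i) i i (T.ch A.X E i))
    (hB1 : ∀ c : complexBetti A.X (2 * 1), IsRationalClass c → IsOfHodgeType A.dim A.X (2 * 1) 1 1 c →
      ∃ a : ℂ, c = a • θ)
    (hB2 : ∀ c : complexBetti A.X (2 * 2), IsRationalClass c → IsOfHodgeType A.dim A.X (2 * 2) 2 2 c →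
      ∃ b : ℂ, c = b • cupPowTwo θ 2)
    (E : A.X.left.Modules) (hE : Motives.IsFiniteLocallyFree E) (hsr : IsZeroOneSemiregular hE)
    (q : ℕ) : ∃ c : ℂ, T.ch A.X E q = c • cupPowTwo θ q := by
  have hV : Motives.IsVectorBundle E := hE.isVectorBundle
  obtain ⟨a, ha⟩ := hB1 _ (T.isRationalClass_ch A.X E hV 1) (hHdg E hE 1)
  obtain ⟨b, hb⟩ := hB2 _ (T.isRationalClass_ch A.X E hV 2) (hHdg E hE 2)
  exact hrig T A θ hθ E hE hsr ⟨a, ha⟩ ⟨b, hb⟩ q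

/-- **Stub 2 of the line is VACUOUS once `WeilSeeds[T]` fails for every `T`** (sorry-free): its
antecedent is then never met. With `stub_weilSectorSeeds_false` (paper level) this is the actual status
of the registered skeleton: Stub 1 false, Stub 2 vacuously true, composition empty. [folklore] -/
theorem stub_seededGeneration_of_forall_not_weilSeeds (h : ∀ T : ChernCharacterBetti, ¬ WeilSeeds[T]) :
    stub_seededGeneration :=
  fun T hT ↦ (h T hT).elim

/-- Conversely Stub 1 and "`WeilSeeds[T]` fails for every `T`" are contradictory (bookkeeping).
[folklore] -/
theorem not_stub_weilSectorSeeds_iff :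
    ¬ stub_weilSectorSeeds ↔ ∀ T : ChernCharacterBetti, ¬ WeilSeeds[T] := by
  unfold stub_weilSectorSeeds
  exact not_exists

/-- The span bookkeeping at the very general fibre, isolated as pure linear algebra (sorry-free): if
every generator of a set `𝒢` is a multiple of `θⁿ`, then so is every element of its `ℂ`-span; so a
class `c` of the span lying in a subspace `Wl` (the Weil plane) meeting `ℂθⁿ` trivially is zero. This
is the last step of Application 1. [folklore] -/
theorem eq_zero_of_mem_span_of_generators_smul {V : Type*} [AddCommGroup V] [Module ℂ V]
    (θn : V) (𝒢 : Set V) (h𝒢 : ∀ x ∈ 𝒢, ∃ a : ℂ, x = a • θn) (Wl : Submodule ℂ V)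
    (hW : ∀ a : ℂ, a • θn ∈ Wl → a • θn = 0) {c : V} (hc : c ∈ Submodule.span ℂ 𝒢) (hcW : c ∈ Wl) :
    c = 0 := by
  have hle : Submodule.span ℂ 𝒢 ≤ Submodule.span ℂ {θn} := by
    refine Submodule.span_le.2 fun x hx ↦ ?_
    obtain ⟨a, rfl⟩ := h𝒢 x hx
    exact Submodule.smul_mem _ a (Submodule.subset_span rfl)
  obtain ⟨a, rfl⟩ := Submodule.mem_span_singleton.1 (hle hc)
  exact hW a hcW

/-- **TARGET KILLED (paper level) — Stub 1 `stub_weilSectorSeeds` of the symmetry-ladder line is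
FALSE.** NEAR-MISS in the sense of this file: the statement is the negation of a registered stub and is
TRUE, but its Lean proof needs objects the tree does not have. WITNESS: `n = 3`, `d = 1`, `(A, φ)` a
very general abelian sixfold of Weil type for `ℚ(i)` (period point outside the countably many proper
special subvarieties of the `9`-dimensional Weil-type Shimura variety), `c ≠ 0` a rational `(3,3)` Weil
class (the Weil plane `E₊ ⊕ E₋ = weilClassesOf A φ 3 1` is spanned by rational Hodge classes there).
PROOF that `¬ Certified[T, A, 3, c]` for every `T`: section docstring, Application 1 (no-go theorem at
every seed point `z_j` after transporting `G₁, G₂` from the very general fibre `s₁`; connectedness of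
`S(ℂ)`; `T.ch = λ^q ch^top`; final step `eq_zero_of_mem_span_of_generators_smul` with `θn = θ³|_{s₁}`,
`Wl` = the Weil plane, which meets `ℂθ³` trivially because `θ³` lies in the `K`-isotypic summand
`∧³V_σ ⊗ ∧³V_σ̄` while `E_± = ∧⁶V_σ, ∧⁶V_σ̄`). LEAN OBSTRUCTION: Hodge decomposition / `B^p` of a very
general Weil-type abelian variety, Kodaira–Spencer classes and BF's `ob_ξ`, Ehresmann transport of
`complexBetti` along smooth projective families, the splitting principle for `ChernCharacterBetti` —
none on real carriers. KERNEL-CHECKED CONDITIONAL FORM: the landed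
`Theorems/HodgeAbelianVarieties/Negative/StubWeilSectorSeedsFalseOf.lean` (p76553) proves this statement
from the four printed inputs `h₁`–`h₄` spelled out there (no-go theorem, flatness, hyperplane class, very
general Weil sixfold), sorry-free; only the inputs are missing here. CLASS (if it were a route item):
refuted-substantive for the stub (no cheap repair keeps `{0,1}`-semiregular locally free seeds: the
repaired seed needs `σ_{n-1}`). [cite: BuchweitzFlenner2003, Cor. 4.3 and Prop. 4.4]
[cite: vanGeemen1994HodgeAV, Thm. 6.12] -/
theorem stub_weilSectorSeeds_false : ¬ stub_weilSectorSeeds := by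
  sorry

/-- What survives for the lead (sorry-free restatement of the dichotomy the no-go theorem leaves): IF
the rigidity conclusion holds for a seed `E` at a point whose `T.ch₁(E)`, `T.ch₂(E)` are multiples of a
polarisation class, its `T.ch_p` is a multiple of `θᵖ`; so a seed whose `T.ch_p` is NOT in `ℂθᵖ` must
have `T.ch₁ ∉ ℂθ` or `T.ch₂ ∉ ℂθ²` — i.e. must sit at a SPECIAL fibre AND be certified by a family along
which those extra classes stay Hodge (which then cannot reach a very general Weil point). [folklore] -/
theorem seed_dichotomy (hrig : ZeroOneSemiregularChernRigidity) (T : ChernCharacterBetti)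
    (A : AbelianVariety ℂ) (θ : complexBetti A.X 2) (hθ : IsPolarizationClass A.dim A.X θ)
    (E : A.X.left.Modules) (hE : Motives.IsFiniteLocallyFree E) (hsr : IsZeroOneSemiregular hE)
    (p : ℕ) (hp : ∀ c : ℂ, T.ch A.X E p ≠ c • cupPowTwo θ p) :
    (∀ a : ℂ, T.ch A.X E 1 ≠ a • θ) ∨ (∀ b : ℂ, T.ch A.X E 2 ≠ b • cupPowTwo θ 2) := by
  by_contra h
  push Not at h
  obtain ⟨⟨a, ha⟩, ⟨b, hb⟩⟩ := h
  obtain ⟨c, hc⟩ := hrig T A θ hθ E hE hsr ⟨a, ha⟩ ⟨b, hb⟩ p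
  exact hp c hc

/-! ### Positive by-product for the lead: Stub 5 (c) is a five-line consequence of the tree -/

/-- **Stub 5 (c) of the symmetry-ladder line, PROVED** (verbatim conjunct of
`Goal.stub_algebraicClassesFunctorial`): pull-back along an isomorphism `e : B.X ≅ Y` of `ℂ`-schemes
maps `algebraicClasses Y p` into `algebraicClasses B.X p` — an isomorphism is flat, `B.X` is locally
Noetherian (smooth projective, `AbelianVariety.isSmoothProjective_holds`) and so is `Y ≅ B.X`; apply the
tree's `map_mem_algebraicClasses_of_flat`. Not a refutation; evidence for the lead (the stub's conjuncts
(a), (b) remain: (b) is not flat). [cite: GrothendieckTopology1969, §1] -/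
theorem stub5c_algebraicClasses_map_iso (B : AbelianVariety ℂ) (Y : Motives.SchemeOver ℂ) (e : B.X ≅ Y)
    (p : ℕ) (y : complexBetti Y (2 * p)) (hy : y ∈ algebraicClasses Y p) :
    complexBetti.map e.hom (2 * p) y ∈ algebraicClasses B.X p := by
  haveI : IsLocallyNoetherian B.X.left :=
    Motives.IsSmoothProjective.isLocallyNoetherian_holds (AbelianVariety.isSmoothProjective_holds (A := B))
  haveI : IsLocallyNoetherian Y.left := isLocallyNoetherian_of_isOpenImmersion e.inv.left
  exact map_mem_algebraicClasses_of_flat e.hom hy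

/-- The third conjunct of `Goal.stub_algebraicClassesFunctorial`, in its registered binder shape,
sorry-free. [cite: GrothendieckTopology1969, §1] -/
theorem stub_algebraicClassesFunctorial_partC :
    ∀ (B : AbelianVariety ℂ) (Y : Motives.SchemeOver ℂ) (e : B.X ≅ Y) (p : ℕ) (y : complexBetti Y (2 * p)),
      y ∈ algebraicClasses Y p → complexBetti.map e.hom (2 * p) y ∈ algebraicClasses B.X p :=
  stub5c_algebraicClasses_map_iso

end SymmetryLadderLine

/-! ## §12 (cycle 4) The picked line `inner-form-invariant-seeds` (gen 3): the C⁺ ladder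
`StarSeeds ⊢ FormalSeeds ⊢ RationalPVHC`, its kill switch (a rational fake p-adic Hodge class), and where
such a class can live

Docblock Findings 17–21 summarise; details for the provers:

**(A) `r = d - 1` is a theorem, so `d ≤ 3` anchors are empty of content.** On a lift `y` (abelian scheme
`𝒴/W(k)`, projective, polarisation `θ ∈ U¹_Hdg(y)`) of a supersingular abelian `d`-fold, hard Lefschetz
`L^{d-2} = θ^{d-2} ∪ · : H²_dR(Y_K) → H^{2d-2}_dR(Y_K)` is bijective, filtered (`θ ∈ F¹`), and
`dim_K F¹H² = C(d,2) + d² = dim_K F^{d-1}H^{2d-2}`, hence a filtered isomorphism; it maps the rational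
algebraic classes `U¹_ℚ` of the special fibre injectively into `U^{d-1}_ℚ`, of the same `ℚ`-dimension
`b₂ = b_{2d-2}` (Lenstra–Zarhin: everything is Lefschetz on a supersingular fibre). So
`U^{d-1}_Hdg(y) = θ^{d-2} · U¹_Hdg(y)`, and `U¹_Hdg(y) = NS(Y_K)_ℚ` by Berthelot–Ogus 3.8 +
Grothendieck–Messing + algebraisation of formal line bundles on abelian schemes: every element of
`U^{d-1}_Hdg(y)` is algebraic on `Y_K`. With `r = 1` (BO) this settles `RationalPVHCFor` for `d ≤ 3`
(drefute g2 recorded the same); the first open cell is `(d, r) = (4, 2)`.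

**(B) Fake classes = one-prime de Rham–Tate classes that are not absolute Hodge.** For `u ∈ U^r_ℚ` with
`bo_y(u) ∈ Fʳ`: `RationalPVHCFor` demands `bo_y(u) ∈ K · A^r(Y_K)`, which forces `u` absolute Hodge on
`Y_K` (Deligne 1982), a condition independent of the complex embedding `ι` (absolute Hodge classes of an
abelian variety over `K` span an `ι`-independent `K̄`-subspace of `H_dR`). Conversely HC|AV + "u absolute
Hodge" gives `RationalPVHCFor` for `u` (Galois-average a `K̄`-cycle; NB every geometric divisor class of
`Y_{K̄}` is already in `U¹_Hdg(y)`, because its de Rham class is `K`-rational — it is `bo` of a rational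
special-fibre class — and lies in `F¹`, so BO lifts it over `W`: no extra divisors over ramified
extensions). So `RationalPVHC` = HC at these anchors + [rational de Rham–Tate at `p` ⇒ absolute Hodge],
and the bracket is open and HC-independent (Ogus 1982 Problem 2.4; Tang 2018 Conj. 8 and Thm. 10;
André 2003 Part III for `ℚ̄`-points). `ℚ_p`-rational fakes exist in codimension 1 (local quaternion
eigenline lifts `E_x` of a supersingular elliptic curve: `End(E_x[p^∞]) ⊋ End(E_x) ⊗ ℤ_p`).

**(C) Where a rational fake can live.** Grothendieck–Messing: lifts of `A₀ = E₀^d ⊗ k` over `W` ↔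
Lagrangian `F ⊂ H¹_cris ⊗ W` lifting `F₀`, graph coordinates `T ∈ Sym_d(pW)` at the CM lift (all of them
algebraise: the product polarisation lifts iff `T` is symmetric). The `ℚ`-structure: `B = End⁰(E₀) =
(-1,-p)_ℚ ↪ M₂(ℚ(i))` (`I = diag(i,-i)`, `Π = (0 1; -p 0)`, `ΠI = -IΠ`, `Π e = -p f` by Mazur's
divisibility), `U¹_ℚ = {⟨x, h y⟩ : h ∈ Herm_d(B)}` (`dim 2d² - d = b₂`), `U^r_ℚ` = products;
`U¹_Hdg(T) = {h : ρ(h) F_T ⊆ F_T} = NS(A_T)_ℚ = End-symmetric part (GM + Serre–Tate);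
`u ∈ F^s(∧^{2s})` iff `ι_{∧^{…}F_T} u = 0` — `Σ_{a<s} h^{a,2s-a}` polynomial equations in `T`.
(i) Germ transport: the p-adic period map `y ↦ F_y` and the complex one near any base point are the same
formal horizontal sections of Gauss–Manin in algebraic local coordinates of `𝒜_{d}` (Katz; convergence on
the residue disc from the F-crystal structure), so the p-adic Hodge locus `Σ_u ∩ disc` and the complex
Hodge locus of the transported class are the `W`- resp. `ℂ`-points of ONE formal germ; if `u` is absolute
Hodge at the base point the complex germ is a union of special subvarieties (Cattani–Deligne–Kaplan;
Deligne–André for abelian schemes) on which `u` is Hodge, hence (HC known in the relevant low dimension,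
or just "absolute Hodge") no fake on any component of `Σ_u ∩ disc` through an absolute-Hodge point — in
particular through CM points (at a CM lift `U^r_Hdg ⊗ = Hdg ⊗`: same torus characters, same Hodge types;
Ogus 4.16). (ii) Count: a fake component contains no such point; for primitive `u ∈ P^{2s}_ℚ` the locus
is cut by `Σ_{a<s} p^{a,2s-a}(A_d)` equations (`p^{a,b} = h^{a,b} - h^{a-1,b-1}`, `h^{a,b} = C(d,a)C(d,b)`)
on a `d(d+1)/2`-dimensional disc: `(d,s) = (4,2)`: `p^{1,3} + p^{0,4} = 10 + 1 = 11 > 10`; `(5,2)`: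
`40 + 5 = 45 > 15`; `(6,2)`: `105 + 15 = 120 > 21`; `(6,3)`: `105 + 21 + 1 = 127 > 21`. Generic rational
classes are p-adically Hodge NOWHERE; the incidence variety does not dominate the space of classes.
(iii) Algebraic points close up: for `T ∈ Sym_d(L)`, `L ⊂ K` a number field, a rational `u` satisfies the
`F^s`-conditions at all `Gal(L̄/ℚ(i))`-conjugates of `F_T` (its coordinates are in `ℚ(i)`), and
`U¹_Hdg(T)` is cut by the conjugate conditions too; e.g. `d = 3`: `T ∈ Sym₃(pℤ[i])` ⇒ `A_T ~ E'³` CM with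
`dim U¹_Hdg = dim U²_Hdg = 9 = dim Hdg⁴(E'³)`; `[L:ℚ] = 4` ⇒ `U¹_Hdg(T) ⊗ K ≅ K[c]` (`c = g⁻¹g'` from the
four Lagrangians `F, F^σ, τF, τF^σ`), a cubic étale algebra of real multiplications, `dim U²_Hdg = 3 =
dim Hdg⁴` — CERTIFIED (exact arithmetic over `ℚ(ζ₈)`, `kit/padic_fake_probe.py`, job j013524; the full
table is in Finding 19): excess `U²_Hdg - Alg² = 0` at every algebraic point for `d = 2, 3, 4`, excess `2` only
for the GENERIC member of the p-adic Weil locus (the rational Weil classes, genuinely Hodge), and p-adic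
tangent dimensions at the CM point `10 / 0 / 6 / 4` for `θ²` / a generic rational Hodge class / `θ₁₂θ₃₄` / a
Weil class. No discrepancy anywhere; a fake would have to sit at a transcendental point of an unlikely
component — not certifiable by finite computation (1 job, a consistency certificate, not a search).

**(D) (⋆) for `G`-rigid special fibres** — see Finding 20: sufficient criterion, no semiregularity, and
the locally-free typing caveat.

Everything below is sorry-free; the C⁺ statements and the engine steps are VERBATIM copies of the
skeleton (which is not an importable module), so the kill-switch theorems apply to the registered stub up
to `def`-unfolding. -/

section CycleFour

open scoped Isocrystal
open Literature.AlgebraicGeometry.Crystalline Literature.AlgebraicGeometry.KTheory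

namespace InnerFormLine

/-! ### Verbatim copies of the gen-3 skeleton's p-adic vocabulary and of the three C⁺ statements
(`Lines/inner-form-invariant-seeds.lean`, commit 6c531cf7f41b, is not an importable module). -/

section Crystalline

variable {p : ℕ} [Fact p.Prime] {k : Type} [Field k] [CharP k p] [PerfectRing k p]

/-- VERBATIM `DivisorClassesAreChern` of the skeleton. -/
def DivisorClassesAreChern (C : CrystallineRealization p k) (X : SchemeOver k) : Prop :=
  ∀ x ∈ C.ratAlgebraicClasses X 1, ∃ N : ℤ, N ≠ 0 ∧
    N • x ∈ AddSubgroup.closure {c | ∃ L : X.left.Modules, HasRank L 1 ∧ c = C.chCris X L 1}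

/-- VERBATIM `RationallyLefschetz` of the skeleton. -/
def RationallyLefschetz (C : CrystallineRealization p k) (X : SchemeOver k) : Prop :=
  ∀ (r : ℕ), ∀ x ∈ C.ratAlgebraicClasses X r, ∃ N : ℤ, N ≠ 0 ∧
    N • x ∈ AddSubgroup.closure
      (Set.range fun D : C.ratAlgebraicClasses X 1 => C.pow X (D : C.obj X 2) r)

/-- VERBATIM `ClassLiftsImplyObjectLifts` (⋆) of the skeleton (= the hypothesis of P1a). -/
def ClassLiftsImplyObjectLifts (𝒳 : SchemeOver (WittVector p k))
    (E₁ : (WittScheme.specialFibre 𝒳).left.Modules) : Prop :=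
  ∀ (n : ℕ) (F : (WittScheme.thickening 𝒳 (n + 1)).left.Modules) (hF : IsFiniteLocallyFree F),
    Nonempty ((Scheme.Modules.pullback (WittScheme.specialFibreToThickening 𝒳 n)).obj F ≅ E₁) →
    (∃ y : KZero (WittScheme.thickening 𝒳 (n + 2)).left,
        KZero.map (WittScheme.thickeningMap 𝒳 (Nat.le_succ (n + 1))) y = KZero.of F hF) →
    ∃ F' : (WittScheme.thickening 𝒳 (n + 2)).left.Modules, IsFiniteLocallyFree F' ∧
      Nonempty ((Scheme.Modules.pullback (WittScheme.thickeningMap 𝒳 (Nat.le_succ (n + 1)))).obj F' ≅ F)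

/-- VERBATIM `ModelHypotheses` of the skeleton (= P1a's standing hypotheses). -/
structure ModelHypotheses (d : ℕ) (𝒳 : SchemeOver (WittVector p k)) : Prop where
  smoothProper : WittScheme.IsSmoothProperModel d 𝒳
  projective : IsProjectiveOverRing 𝒳
  large : d + 6 < p
  torsionFree_structureSheaf :
    ∀ (b : ℕ) (x : structureSheafCohomology 𝒳.left b), (p : ℤ) • x = 0 → x = 0
  torsionFree_hodgeOne : ∀ (b : ℕ) (x : hodgeCohomologyOne 𝒳 b), (p : ℤ) • x = 0 → x = 0
  cotangent_free : d ≤ 3 ∨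
    Nonempty (cotangentSheaf 𝒳 ≅ SheafOfModules.free (R := 𝒳.left.ringCatSheaf) (Fin d))

/-- VERBATIM `starSeedClasses` of the skeleton. -/
def starSeedClasses (C : CrystallineRealization p k) (𝒴 : SchemeOver (WittVector p k)) (r : ℕ) :
    Set (C.obj (WittScheme.specialFibre 𝒴) (2 * r)) :=
  {x | ∃ (E : (WittScheme.specialFibre 𝒴).left.Modules) (_ : IsFiniteLocallyFree E),
      C.HodgeCondition 𝒴 E ∧ ClassLiftsImplyObjectLifts 𝒴 E ∧
        x = C.chCris (WittScheme.specialFibre 𝒴) E r}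

/-- VERBATIM `StarSeedsFor` of the skeleton. -/
def StarSeedsFor (C : CrystallineRealization p k) (d : ℕ) (𝒴 : SchemeOver (WittVector p k)) : Prop :=
  ∀ (r : ℕ), 1 ≤ r → r < d → ∀ u ∈ C.ratAlgebraicClasses (WittScheme.specialFibre 𝒴) r,
    C.bo 𝒴 (2 * r) u ∈ C.dR.fil (2 * r) r →
    ∃ N : ℤ, N ≠ 0 ∧ N • u ∈ AddSubgroup.closure (starSeedClasses C 𝒴 r)

/-- VERBATIM `formalSeedClasses` of the skeleton. -/
def formalSeedClasses (C : CrystallineRealization p k) (𝒴 : SchemeOver (WittVector p k)) (r : ℕ) :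
    Set (C.obj (WittScheme.specialFibre 𝒴) (2 * r)) :=
  {x | ∃ E : (WittScheme.specialFibre 𝒴).left.Modules, WittScheme.LiftsFormally 𝒴 E ∧
      x = C.chCris (WittScheme.specialFibre 𝒴) E r}

/-- VERBATIM `FormalSeedsFor` of the skeleton. -/
def FormalSeedsFor (C : CrystallineRealization p k) (d : ℕ) (𝒴 : SchemeOver (WittVector p k)) : Prop :=
  ∀ (r : ℕ), 1 ≤ r → r < d → ∀ u ∈ C.ratAlgebraicClasses (WittScheme.specialFibre 𝒴) r,
    C.bo 𝒴 (2 * r) u ∈ C.dR.fil (2 * r) r →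
    ∃ N : ℤ, N ≠ 0 ∧ N • u ∈ AddSubgroup.closure (formalSeedClasses C 𝒴 r)

/-- VERBATIM `RationalPVHCFor` of the skeleton. -/
def RationalPVHCFor (C : CrystallineRealization p k) (d : ℕ) (𝒴 : SchemeOver (WittVector p k)) : Prop :=
  ∀ (r : ℕ), 1 ≤ r → r < d → ∀ u ∈ C.ratAlgebraicClasses (WittScheme.specialFibre 𝒴) r,
    C.bo 𝒴 (2 * r) u ∈ C.dR.fil (2 * r) r →
    C.bo 𝒴 (2 * r) u ∈ Submodule.span K(p, k)
      (C.dR.ratAlgebraicClasses (WittScheme.genericFibre 𝒴) r :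
        Set (C.dR.obj (WittScheme.genericFibre 𝒴) (2 * r)))

/-- The common hypothesis prefix of the three C⁺'s at one anchor `(C, d, 𝒴, A₀)`, VERBATIM. -/
def AnchorHypotheses (C : CrystallineRealization p k) (d : ℕ) (𝒴 : SchemeOver (WittVector p k))
    (A₀ : AbelianVariety k) : Prop :=
  C.BerthelotOgusLineBundleLifting ∧ BlochEsnaultKerzLifting C ∧
    ModelHypotheses d 𝒴 ∧ A₀.X = WittScheme.specialFibre 𝒴 ∧ A₀.IsSupersingular ∧
    DivisorClassesAreChern C (WittScheme.specialFibre 𝒴) ∧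
    RationallyLefschetz C (WittScheme.specialFibre 𝒴) ∧
    LenstraZarhin1993_supersingular_lefschetzClasses_eq_top C.toWeilCohomology A₀

end Crystalline

/-- VERBATIM `StarSeeds` (= registered `stub_starSeeds`, promoted by the lead to the P2a chain). -/
def StarSeeds : Prop :=
  ∀ (p : ℕ) [Fact p.Prime] (k : Type) [Field k] [CharP k p] [PerfectRing k p] [IsAlgClosed k]
    (C : CrystallineRealization p k),
    C.BerthelotOgusLineBundleLifting → BlochEsnaultKerzLifting C →
    ∀ ⦃d : ℕ⦄ ⦃𝒴 : SchemeOver (WittVector p k)⦄ (A₀ : AbelianVariety k),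
      ModelHypotheses d 𝒴 → A₀.X = WittScheme.specialFibre 𝒴 → A₀.IsSupersingular →
      DivisorClassesAreChern C (WittScheme.specialFibre 𝒴) →
      RationallyLefschetz C (WittScheme.specialFibre 𝒴) →
      LenstraZarhin1993_supersingular_lefschetzClasses_eq_top C.toWeilCohomology A₀ →
      StarSeedsFor C d 𝒴

/-- VERBATIM `FormalSeeds` (fallback C⁺ no. 1). -/
def FormalSeeds : Prop :=
  ∀ (p : ℕ) [Fact p.Prime] (k : Type) [Field k] [CharP k p] [PerfectRing k p] [IsAlgClosed k]
    (C : CrystallineRealization p k),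
    C.BerthelotOgusLineBundleLifting → BlochEsnaultKerzLifting C →
    ∀ ⦃d : ℕ⦄ ⦃𝒴 : SchemeOver (WittVector p k)⦄ (A₀ : AbelianVariety k),
      ModelHypotheses d 𝒴 → A₀.X = WittScheme.specialFibre 𝒴 → A₀.IsSupersingular →
      DivisorClassesAreChern C (WittScheme.specialFibre 𝒴) →
      RationallyLefschetz C (WittScheme.specialFibre 𝒴) →
      LenstraZarhin1993_supersingular_lefschetzClasses_eq_top C.toWeilCohomology A₀ →
      FormalSeedsFor C d 𝒴

/-- VERBATIM `RationalPVHC` (fallback C⁺ no. 2). -/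
def RationalPVHC : Prop :=
  ∀ (p : ℕ) [Fact p.Prime] (k : Type) [Field k] [CharP k p] [PerfectRing k p] [IsAlgClosed k]
    (C : CrystallineRealization p k),
    C.BerthelotOgusLineBundleLifting → BlochEsnaultKerzLifting C →
    ∀ ⦃d : ℕ⦄ ⦃𝒴 : SchemeOver (WittVector p k)⦄ (A₀ : AbelianVariety k),
      ModelHypotheses d 𝒴 → A₀.X = WittScheme.specialFibre 𝒴 → A₀.IsSupersingular →
      DivisorClassesAreChern C (WittScheme.specialFibre 𝒴) →
      RationallyLefschetz C (WittScheme.specialFibre 𝒴) →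
      LenstraZarhin1993_supersingular_lefschetzClasses_eq_top C.toWeilCohomology A₀ →
      RationalPVHCFor C d 𝒴

/-! ### (a) Degenerate anchors: no content below relative dimension 2 -/

section Degenerate

variable {p : ℕ} [Fact p.Prime] {k : Type} [Field k] [CharP k p] [PerfectRing k p]

/-- For `d ≤ 1` all three local C⁺'s hold VACUOUSLY (there is no `r` with `1 ≤ r < d`): points and
curves carry no content; by BO 3.8 (`r = 1`) and the hard-Lefschetz filtered isomorphism
`L^{d-2} : F¹H² ⥲ F^{d-1}H^{2d-2}` (`r = d - 1`, see the §12 docblock) the first degree with content in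
print is `(d, r) = (4, 2)`. [folklore] -/
theorem rationalPVHCFor_of_le_one (C : CrystallineRealization p k) {d : ℕ} (hd : d ≤ 1)
    (𝒴 : SchemeOver (WittVector p k)) : RationalPVHCFor C d 𝒴 :=
  fun r h1 hrd => absurd (lt_of_lt_of_le (lt_of_lt_of_le h1 hrd.le) hd) (by omega)

theorem formalSeedsFor_of_le_one (C : CrystallineRealization p k) {d : ℕ} (hd : d ≤ 1)
    (𝒴 : SchemeOver (WittVector p k)) : FormalSeedsFor C d 𝒴 :=
  fun r h1 hrd => absurd (lt_of_lt_of_le (lt_of_lt_of_le h1 hrd.le) hd) (by omega)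

theorem starSeedsFor_of_le_one (C : CrystallineRealization p k) {d : ℕ} (hd : d ≤ 1)
    (𝒴 : SchemeOver (WittVector p k)) : StarSeedsFor C d 𝒴 :=
  fun r h1 hrd => absurd (lt_of_lt_of_le (lt_of_lt_of_le h1 hrd.le) hd) (by omega)

end Degenerate

/-! ### (b) The kill switch: a RATIONAL FAKE p-ADIC HODGE CLASS at one supersingular abelian anchor
sinks all three C⁺'s as typed (`∀` over ALL anchors), without touching the crux -/

section Fake

variable {p : ℕ} [Fact p.Prime] {k : Type} [Field k] [CharP k p] [PerfectRing k p]

/-- A **rational fake p-adic Hodge class** on the model `𝒴` in a middle degree `1 ≤ r < d` (relative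
to `C`): a rational algebraic class `u` of the SPECIAL fibre whose Berthelot–Ogus image lies in
`Fʳ H²ʳ_dR(Y_K/K)` ("p-adically Hodge", = Ogus/Tang de Rham–Tate at the single prime `p`) but NOT in the
`K`-span of the algebraic classes of the generic fibre. On the classical value of `C` and an abelian
scheme `𝒴/W(𝔽̄_p)`: `u` is de Rham–Tate at `p` but not absolute Hodge (Deligne: algebraic ⟹ absolute
Hodge; HC|AV ⟹ converse), i.e. a one-prime counterexample to "de Rham–Tate ⟹ Hodge" — OPEN, not implied
by the Hodge conjecture (Ogus 1982 Problem 2.4 / Tang 2018 Conj. 8 need cofinitely many primes over a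
number field; Y. Tang, Compositio 154 (2018) = arXiv:1510.01357, Def. 5, Conj. 8, Thm. 10, read). [folklore] -/
def HasRationalFakeClass (C : CrystallineRealization p k) (d : ℕ) (𝒴 : SchemeOver (WittVector p k)) :
    Prop :=
  ∃ r : ℕ, 1 ≤ r ∧ r < d ∧ ∃ u ∈ C.ratAlgebraicClasses (WittScheme.specialFibre 𝒴) r,
    C.bo 𝒴 (2 * r) u ∈ C.dR.fil (2 * r) r ∧
    C.bo 𝒴 (2 * r) u ∉ Submodule.span K(p, k)
      (C.dR.ratAlgebraicClasses (WittScheme.genericFibre 𝒴) r :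
        Set (C.dR.obj (WittScheme.genericFibre 𝒴) (2 * r)))

/-- `RationalPVHCFor` FAILS at `𝒴` iff `𝒴` carries a rational fake class (definitional). [folklore] -/
theorem not_rationalPVHCFor_iff (C : CrystallineRealization p k) (d : ℕ)
    (𝒴 : SchemeOver (WittVector p k)) : ¬ RationalPVHCFor C d 𝒴 ↔ HasRationalFakeClass C d 𝒴 := by
  constructor
  · intro h
    by_contra hne
    apply h
    intro r h1 hrd u hu hfil
    by_contra hnot
    exact hne ⟨r, h1, hrd, u, hu, hfil, hnot⟩
  · rintro ⟨r, h1, hrd, u, hu, hfil, hnot⟩ h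
    exact hnot (h r h1 hrd u hu hfil)

/-- VERBATIM `bo_chCris_mem_span_of_liftsTo` of the skeleton: classes of algebraically liftable
modules are algebraic on the generic fibre. -/
theorem bo_chCris_mem_span_of_liftsTo (C : CrystallineRealization p k) {d : ℕ}
    {𝒴 : SchemeOver (WittVector p k)} (h𝒴 : WittScheme.IsSmoothProperModel d 𝒴)
    {E₁ : (WittScheme.specialFibre 𝒴).left.Modules} (hL : WittScheme.LiftsTo 𝒴 E₁) (r : ℕ) :
    C.bo 𝒴 (2 * r) (C.chCris (WittScheme.specialFibre 𝒴) E₁ r) ∈ Submodule.span K(p, k)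
      (C.dR.ratAlgebraicClasses (WittScheme.genericFibre 𝒴) r :
        Set (C.dR.obj (WittScheme.genericFibre 𝒴) (2 * r))) := by
  obtain ⟨E, hE, ⟨e⟩⟩ := hL
  rw [← C.chCris_congr e r, C.bo_chCris h𝒴 E hE r]
  exact Submodule.subset_span (C.chDR_mem_ratAlgebraicClasses h𝒴.isSmoothProjective_genericFibre _ r)

/-- VERBATIM `bo_mem_span_of_zsmul_mem_closure` of the skeleton (`ℚ`-saturation). -/
theorem bo_mem_span_of_zsmul_mem_closure (C : CrystallineRealization p k)
    (𝒴 : SchemeOver (WittVector p k)) (r : ℕ) {S : Set (C.obj (WittScheme.specialFibre 𝒴) (2 * r))}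
    (hS : ∀ x ∈ S, C.bo 𝒴 (2 * r) x ∈ Submodule.span K(p, k)
      (C.dR.ratAlgebraicClasses (WittScheme.genericFibre 𝒴) r :
        Set (C.dR.obj (WittScheme.genericFibre 𝒴) (2 * r))))
    {u : C.obj (WittScheme.specialFibre 𝒴) (2 * r)} {N : ℤ} (hN : N ≠ 0)
    (hu : N • u ∈ AddSubgroup.closure S) :
    C.bo 𝒴 (2 * r) u ∈ Submodule.span K(p, k)
      (C.dR.ratAlgebraicClasses (WittScheme.genericFibre 𝒴) r :
        Set (C.dR.obj (WittScheme.genericFibre 𝒴) (2 * r))) := by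
  set V := (Submodule.span K(p, k)
      (C.dR.ratAlgebraicClasses (WittScheme.genericFibre 𝒴) r :
        Set (C.dR.obj (WittScheme.genericFibre 𝒴) (2 * r)))).comap (C.bo 𝒴 (2 * r)) with hV
  have hle : AddSubgroup.closure S ≤ V.toAddSubgroup :=
    (AddSubgroup.closure_le _).2 fun x hx => hS x hx
  have hNu : N • u ∈ V := hle hu
  have hNK : ((N : ℤ) : K(p, k)) ≠ 0 := Int.cast_ne_zero.2 hN
  have hu' : u = ((N : K(p, k))⁻¹) • ((N : K(p, k)) • u) := by
    rw [smul_smul, inv_mul_cancel₀ hNK, one_smul]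
  have key : u ∈ V := by
    rw [hu']
    refine V.smul_mem _ ?_
    rw [Int.cast_smul_eq_zsmul]
    exact hNu
  exact key

/-- VERBATIM engine step of the skeleton (P3a): formal seeds give rational pVHC. -/
theorem rationalPVHCFor_of_formalSeedsFor (hP3a : FormalVectorBundlesAlgebraize)
    (C : CrystallineRealization p k) {d : ℕ} {𝒴 : SchemeOver (WittVector p k)}
    (h𝒴 : WittScheme.IsSmoothProperModel d 𝒴) (hF : FormalSeedsFor C d 𝒴) : RationalPVHCFor C d 𝒴 := by
  intro r h1 hrd u hu hfil
  obtain ⟨N, hN, hNu⟩ := hF r h1 hrd u hu hfil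
  refine bo_mem_span_of_zsmul_mem_closure C 𝒴 r ?_ hN hNu
  rintro _ ⟨E, hE, rfl⟩
  exact bo_chCris_mem_span_of_liftsTo C h𝒴 (hP3a p k d 𝒴 h𝒴 E hE) r

/-- VERBATIM engine step of the skeleton (P1a + BEK): (⋆)-seeds are formal seeds. -/
theorem formalSeedsFor_of_starSeedsFor (hP1a : FormalLiftingFromClassLifting)
    (C : CrystallineRealization p k) (hBEK : BlochEsnaultKerzLifting C) {d : ℕ}
    {𝒴 : SchemeOver (WittVector p k)} (h : ModelHypotheses d 𝒴) (hS : StarSeedsFor C d 𝒴) :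
    FormalSeedsFor C d 𝒴 := by
  intro r h1 hrd u hu hfil
  obtain ⟨N, hN, hNu⟩ := hS r h1 hrd u hu hfil
  refine ⟨N, hN, AddSubgroup.closure_mono ?_ hNu⟩
  rintro _ ⟨E, hE, hH, hstar, rfl⟩
  exact ⟨E, hP1a p k d 𝒴 h.smoothProper h.projective h.large h.torsionFree_structureSheaf
    h.torsionFree_hodgeOne h.cotangent_free E hE hstar
    (exists_lift_of_hodgeConditionKZeroRat C hBEK h.smoothProper h.projective h.large
      ((C.hodgeConditionKZeroRat_of 𝒴 E hE).2 hH)), rfl⟩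

/-- **One fake kills `FormalSeedsFor`** at that anchor (modulo the route's KNOWN support item P3a,
Grothendieck existence). [folklore] -/
theorem not_formalSeedsFor_of_fake (hP3a : FormalVectorBundlesAlgebraize)
    (C : CrystallineRealization p k) {d : ℕ} {𝒴 : SchemeOver (WittVector p k)}
    (h𝒴 : WittScheme.IsSmoothProperModel d 𝒴) (hf : HasRationalFakeClass C d 𝒴) :
    ¬ FormalSeedsFor C d 𝒴 := fun hF =>
  (not_rationalPVHCFor_iff C d 𝒴).2 hf (rationalPVHCFor_of_formalSeedsFor hP3a C h𝒴 hF)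

/-- **One fake kills `StarSeedsFor`** at that anchor (modulo P1a — the route's OPEN crux r2 — and P3a).
[folklore] -/
theorem not_starSeedsFor_of_fake (hP1a : FormalLiftingFromClassLifting)
    (hP3a : FormalVectorBundlesAlgebraize) (C : CrystallineRealization p k)
    (hBEK : BlochEsnaultKerzLifting C) {d : ℕ} {𝒴 : SchemeOver (WittVector p k)}
    (h : ModelHypotheses d 𝒴) (hf : HasRationalFakeClass C d 𝒴) : ¬ StarSeedsFor C d 𝒴 := fun hS =>
  not_formalSeedsFor_of_fake hP3a C h.smoothProper hf (formalSeedsFor_of_starSeedsFor hP1a C hBEK h hS)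

end Fake

/-- **A fake anchor**: SOME supersingular abelian anchor satisfying every hypothesis of the three C⁺'s
(VERBATIM prefix) that carries a rational fake p-adic Hodge class. Not constructible in the tree (no
value of `CrystallineRealization`, no positive-dimensional `IsSmoothProperModel`); on paper its
existence is OPEN and is NOT excluded by the Hodge conjecture (§12 docblock: it is an "unlikely
intersection" — at `(d, r) = (4, 2)` eleven equations on the ten-dimensional disc of lifts). -/
def FakeAnchorExists : Prop :=
  ∃ (p : ℕ) (_ : Fact p.Prime) (k : Type) (_ : Field k) (_ : CharP k p) (_ : PerfectRing k p)
    (_ : IsAlgClosed k) (C : CrystallineRealization p k) (d : ℕ) (𝒴 : SchemeOver (WittVector p k))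
    (A₀ : AbelianVariety k), AnchorHypotheses C d 𝒴 A₀ ∧ HasRationalFakeClass C d 𝒴

/-- **Kill switch, C⁺ no. 2**: a fake anchor refutes `RationalPVHC` as typed (unconditionally).
[folklore] -/
theorem not_rationalPVHC_of_fakeAnchor (hf : FakeAnchorExists) : ¬ RationalPVHC := by
  rintro hR
  obtain ⟨p, _, k, _, _, _, _, C, d, 𝒴, A₀, ⟨hBO, hBEK, hM, hsp, hss, hdiv, hlef, hLZ⟩, hfake⟩ := hf
  exact (not_rationalPVHCFor_iff C d 𝒴).2 hfake (hR p k C hBO hBEK A₀ hM hsp hss hdiv hlef hLZ)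

/-- **Kill switch, C⁺ no. 1**: a fake anchor refutes `FormalSeeds` modulo P3a (known). [folklore] -/
theorem not_formalSeeds_of_fakeAnchor (hP3a : FormalVectorBundlesAlgebraize) (hf : FakeAnchorExists) :
    ¬ FormalSeeds := by
  rintro hF
  obtain ⟨p, _, k, _, _, _, _, C, d, 𝒴, A₀, ⟨hBO, hBEK, hM, hsp, hss, hdiv, hlef, hLZ⟩, hfake⟩ := hf
  exact not_formalSeedsFor_of_fake hP3a C hM.smoothProper hfake
    (hF p k C hBO hBEK A₀ hM hsp hss hdiv hlef hLZ)

/-- **Kill switch, the registered stub**: a fake anchor refutes `StarSeeds` (= `stub_starSeeds`) modulo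
P1a ∧ P3a. So as typed — `∀` over ALL supersingular abelian anchors, while the composition
`HodgeAbelianVarieties_of` consumes the local statement only at the Kisin anchors of stub 1 — the stub
is exposed to fake classes at anchors the line never uses. REPAIR (misstatement insurance, for the
planner): quantify the three C⁺'s over the stub-1 anchors (`∃`-packaged `Anchor` with `IsGenuine ∧
SpansHodge`), or add the hypothesis `¬ HasRationalFakeClass C d 𝒴` / restrict `u` to `U^{I_x}`.
[folklore] -/
theorem not_starSeeds_of_fakeAnchor (hP1a : FormalLiftingFromClassLifting)
    (hP3a : FormalVectorBundlesAlgebraize) (hf : FakeAnchorExists) : ¬ StarSeeds := by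
  rintro hS
  obtain ⟨p, _, k, _, _, _, _, C, d, 𝒴, A₀, ⟨hBO, hBEK, hM, hsp, hss, hdiv, hlef, hLZ⟩, hfake⟩ := hf
  exact not_starSeedsFor_of_fake hP1a hP3a C hBEK hM hfake (hS p k C hBO hBEK A₀ hM hsp hss hdiv hlef hLZ)

/-- Conversely the three C⁺'s are NESTED as typed (VERBATIM global engine): `StarSeeds → FormalSeeds`
modulo P1a, `FormalSeeds → RationalPVHC` modulo P3a — so `RationalPVHC` is the weakest and a fake anchor
is the ONLY way any of them can fail without (⋆)/formal-lifting failing. [folklore] -/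
theorem rationalPVHC_of_starSeeds (hP1a : FormalLiftingFromClassLifting)
    (hP3a : FormalVectorBundlesAlgebraize) (h : StarSeeds) : RationalPVHC :=
  fun p _ k _ _ _ _ C hBO hBEK _ _ A₀ hM hsp hss hdiv hlef hLZ =>
    rationalPVHCFor_of_formalSeedsFor hP3a C hM.smoothProper
      (formalSeedsFor_of_starSeedsFor hP1a C hBEK hM (h p k C hBO hBEK A₀ hM hsp hss hdiv hlef hLZ))

/-- The dichotomy left to the lead (sorry-free bookkeeping): modulo P1a ∧ P3a, EITHER no supersingular
abelian anchor carries a rational fake class, OR the registered stub is false. [folklore] -/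
theorem starSeeds_dichotomy (hP1a : FormalLiftingFromClassLifting) (hP3a : FormalVectorBundlesAlgebraize) :
    ¬ FakeAnchorExists ∨ ¬ StarSeeds := by
  by_cases hf : FakeAnchorExists
  · exact Or.inr (not_starSeeds_of_fakeAnchor hP1a hP3a hf)
  · exact Or.inl hf

end InnerFormLine

end CycleFour

/-! ## §6 Why the crux resists disproof (record for ideators / provers)

* NO CERTIFICATE OF NON-ALGEBRAICITY ON ABELIAN VARIETIES. The classical ways to prove a Hodge class is
  NOT algebraic are (a) it is not absolute Hodge / not Galois-compatible, (b) it is not a Tate class at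
  some prime, (c) integral obstructions (Atiyah–Hirzebruch operations, divisibility/degeneration as in
  Kollár or Engel–de Gaay Fortman–Schreieder), (d) Kähler deformation to a torus without subvarieties.
  On abelian varieties (a) and (b) are dead: Hodge classes are absolute Hodge (Deligne 1982; tree
  `Literature.Barriers.HodgeConjecture.hodgeClassesAreAbsoluteFor_abelianVariety`) and potentially Tate,
  even MOTIVATED (André 1996 Thm. 0.6.2; tree
  `Literature.Barriers.HodgeConjecture.Andre1996_hodgeClassesOnAbelianVarieties_motivated`), so a
  counterexample would refute Grothendieck's standard conjecture `B` for total spaces of compact pencils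
  of abelian varieties (André, §6.3 Rem. 2); (c) only ever removes INTEGRAL refinements (§4: the
  rational class `½[Z]` survives); (d) shows the analytic analogue fails (§5) but says nothing about
  algebraic tori. No invariant distinguishing "rational Hodge" from "algebraic" on an abelian variety is
  known — which is also why `kit compute` has nothing to certify: algebraicity is a Σ₁ search for cycles,
  non-algebraicity has no finite witness.
* THE ONLY COMPUTATIONAL PROGRAMME IN PRINT IS BARREN WHERE IT WAS RUN. Kontsevich–Zharkov
  (arXiv:2002.02347): disprove the TROPICAL Hodge conjecture on the 4-parameter family of tropical Weil
  fourfolds `X_{a,b,c,e}` (polarisation matrix `Q`, Weil classes `w₁, w₂ ∈ Sym²Γ_p ⊗ Sym²(∧²Γ₂)`) by a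
  linear functional `Φ ∘ α` killing all tropical cycles modulo a proper sublattice of `ℤ⟨θ, w₁, w₂⟩`;
  a generic member of the degenerating family `X_ε` would then be a classical counterexample. Outcome in
  print: the finite linear system of the natural ansatz "can be solved explicitly, but unfortunately the
  solution does not hold modulo any proper sublattice". Since 2025 this HAD to fail: Weil classes on ALL
  abelian fourfolds of Weil type are algebraic (Markman; tree fact
  `Markman2025_weilClasses_algebraic_abelianFourfold`), so every tropical limit of Weil fourfolds
  satisfies the tropical Hodge conjecture for `w₁, w₂`. A re-run would need tropical Weil SIXFOLDS of
  non-split type (`∧³`, a 9-dimensional Weil moduli, discriminant bookkeeping) with no guarantee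
  ("the converse implication though may be false"). CYCLE 2 (note read in full): the scheme is not
  finite even in dimension 4 — the unknown `Φ_{x,u}` is indexed by `x ∈ (Γ₂ ⊗ Γ_p)/Γ₁ ≅ ℤ¹²`, `u ∈ ℚℙ³`;
  finiteness came only from a linearity ansatz that fails; the implication "tropical failure ⇒ classical
  counterexample on a generic `X_ε`" is asserted without proof in the 4-page note; so there is no
  certificate-producing job to submit, in any dimension, until someone supplies (a) a proof of that
  implication and (b) a finite-dimensional reduction of the cocycle equations that is not an ansatz.
* HODGE'S ORIGINAL GENERAL CONJECTURE IS FALSE ON ABELIAN VARIETIES TOO (Grothendieck 1969, `E³` with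
  `τ` cubic: `rank_ℚ(H³ ∩ F¹) = 5` is odd, `N¹H³` has even rank; tree barrier
  `Grothendieck1969_generalHodgeConjecture_false`): classwise level criteria ("a rational class in `Fᵖ`
  is supported in codimension `p`") cannot be an intermediate step of a proof of the crux off the CM
  locus; on CM abelian varieties they coincide with GHC (tree `GeneralizedHodgeTrivialReasonsNarrow`).
* 2026 FRONTIER (arXiv:2603.20268, read): a rigid one-parameter family of Weil-type SIXFOLDS over
  McMullen's Teichmüller curve `V ⊂ X_L` (`L = ℚ(cos π/21)`), Weil classes absolute Hodge "yet
  inaccessible to all known methods", uncontrolled discriminant; whether `V ∩ 𝒲_K ≠ ∅` is reduced to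
  three finite problems O1–O3. These would be the sharpest CANDIDATE counterexamples in print — and
  equally the sharpest test cases for this route's P2a (seeds at a supersingular anchor of a CM
  sixfold with CM field `KL` of degree 12).
* FRONTIER (where a counterexample must live, print level): `dim A ≥ 6` (HC holds for abelian varieties
  of dimension `≤ 5`: Markman, arXiv:2509.23403 Cor. 1.3); not divisor-generated Hodge ring (excludes
  the general abelian variety — Mattuck —, products of elliptic curves — Tate/Imai/Murasaki —, simple
  abelian varieties of prime dimension — Tankeev/Ribet); for CM abelian varieties it suffices to look
  at split Weil classes (André 1992 = Markman survey Thm. 1.4), which Markman's secant-sheaf programme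
  attacks; the named open cases are Weil classes on Weil-type SIXFOLDS of discriminant `≠ -1` and on
  general Weil-type `2n`-folds, `2n ≥ 8` (arXiv:2603.20268 p. 3; van Geemen LNM 1594 Thm. 4.11), i.e.
  the typed items `TropicalCuspLift.WeilSixfolds` / `WeilClassesAlgebraic` (§3).
* DEGENERATE AND LIMIT REGIMES ARE ALL POSITIVE: `dim 0` (§2), extreme codimensions (§3), `dim ≤ 3`
  (Lefschetz), self-products `Eⁿ` and CM anchors `Eⁿ`-isogenous (Hodge ring divisor-generated or
  Weil-generated and known), supersingular reductions (Tate free) — the route's anchors sit exactly on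
  the known side, so no "first p-adic test" of the crux itself can fail; only P1b/P2a can.

## Targets

CYCLE 4: line `inner-form-invariant-seeds` gen 3 (commit 6c531cf7f41b; payload `targets = []`,
`stuck_stubs = []`; lead ended `promote-stub: stub_starSeeds`). `stub_innerFormAnchors`: true in print,
construction-blocked (C1–C5), `∃` over real carriers — not attackable. `stub_starSeeds` (= `StarSeeds`,
§12): NOT killed; refutable only via a FAKE ANCHOR (`InnerFormLine.not_starSeeds_of_fakeAnchor`, modulo
P1a ∧ P3a; a rational one-prime de Rham–Tate class that is not absolute Hodge — open, HC-independent,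
unlikely-intersection protected, Findings 17–19) or via failure of (⋆) for every locally free seed of a
needed class (Finding 20: (⋆) holds for `G`-rigid special fibres of global bundles; typed seeds must be
locally free while the Weil sheaves in print are reflexive). Content-free cells: `d ≤ 1` (proved,
`…_of_le_one`), `r = 1` (BO), `r = d - 1` (Lefschetz, §12 (A)); first open cell `(4, 2)`.

CYCLE 3: the six registered stubs of `Lines/symmetry-ladder-isotypic-obstructions.lean` (skeleton
782f9e98e2a6; payload `targets = []` but the stubs are active on the item): Stub 1 `stub_weilSectorSeeds`
BROKEN at paper level (§11, no-go theorem; `NegativeNoteStubWeilSectorSeeds.md`; kernel-checked conditional form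
`Negative/StubWeilSectorSeedsFalseOf.lean`, p76553), Stub 2 vacuous, Stub 5 (c) PROVED (§11), Stubs 3–6
HC-implied / theorems in print (re-audited: `stub_baireSpreading` handles complex `G` via a
`ℚ`-independent decomposition; `stub_semiregularVHC` is BF Cor. 4.3 + Prop. 4.4 + Pridham + Artin and
is TRUE but, by §11, only ever fires on classes in `ℂ[Θ]` when `G₁, G₂ ∈ ℂΘ, ℂΘ²`). Earlier: none (cycles 1–2: payload `targets = []`, `stuck_stubs = []`; triage r1 done — passing cards
`subtorus-gallery-bloch-seeds`, `e-step-secant-induction` (3/3), `inner-form-invariant-seeds`,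
`symmetry-ladder-isotypic-obstructions` (2/3); no PICKED.md yet). Pre-emptive notes for the lead on the
typed first lemmas (`IdeatorTwoSketch.lean`): `ker_map_eq_of_ker_eq` is TRUE and needs no
surjectivity (`ker (f ⊗ g) = ker f ⊗ A₂ + A₁ ⊗ ker g` over a field, both sides); `HasBlochWeilSeed n d`
is decoration modulo existence of a hyperbolic Weil-type `(A₀, φ₀, h₀)` with a non-zero Weil class
(the `∃ D : SubschemeSemiregularityData` is junk-inhabitable as soon as a Hodge model of `A₀.X` is
granted — all three triagers), so `weilAlgebraicHyperbolic_of_blochSeed` as typed claims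
`WeilAlgebraicHyperbolic n d` outright. -/

end Summit.HodgeConjecture.HodgeConjecture.Cruxes.HodgeAbelianVarieties.Disproof

end
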